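import Summits.SmoothPoincare4.SmoothPoincare4.Theorems.ConvexBisectionAcyclicBisectionExistsHurwitzMoveSwap
import Summits.SmoothPoincare4.SmoothPoincare4.Theorems.ConvexBisectionAcyclicBisectionExistsHurwitzMoveTransferLink
import Summits.SmoothPoincare4.SmoothPoincare4.Theorems.ConvexBisectionAcyclicBisectionExistsHurwitzMoveClasses
import Summits.SmoothPoincare4.SmoothPoincare4.Theorems.ConvexBisectionAcyclicBisectionExistsBeltMonodromyPages
import Summits.SmoothPoincare4.SmoothPoincare4.Theorems.ConvexBisectionAcyclicBisectionExistsPageRotationFlow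
import Summits.SmoothPoincare4.SmoothPoincare4.Theorems.ConvexBisectionAcyclicBisectionExistsPageInvariance
import Literature.Topology.FourManifolds.HandleAttachingMapsShrink
import Literature.Geometry.Symplectic.LefschetzSteinOpenBookBaseTransport
import HarnessLib

/-!
# N1 DESIGN v2 (worker H7, lead c5, wave 7, 2026-08-17) — `stub_M2geo` ▸ `node_N1_move` ▸
# THE CONTRACT `node_N1_move ⇐ (a) ∧ (c) ∧ (d) ∧ (e)`, line `modp-braid-orbits`,
# crux `ConvexBisection.AcyclicBisectionExists` (stmt-SmoothPoincare4-10508)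

`lean check`: rc 0; `node_N1_move` (G4's text VERBATIM = hypothesis `hmove` of the landed `swap_of_move`)
is PROVED here from the pieces; the sorries live ONLY in the pieces `piece_c1`, `piece_c2` (the slice
constructions), `piece_d` (H4's belt chart, H4's node) and `piece_e_cross` (the bridge from the belt chart
to shadows).  The top `n1_design_v2` = `sig_stub_M2geo.txt` VERBATIM and `hs_of_n1_v2` follow by G4's
landed chain.

## DAG (v2) with honest sizes (lines of Lean on top of the tree of 2026-08-17, 17:30 UTC)

    stub_M2geo  = m2geo_of_transfer ∘ transfer_of_swap' ∘ swap_of_move (node_N1_move)     G4, ALL LANDED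
    node_N1_move := node_N1_move_of_pieces piece_c1 piece_c2 piece_dsh piece_e_free          H7, LANDED
        (…HurwitzMoveDichotomy.lean p170781 ACCEPTED: rigid rotation, clauses_of_dichotomy, subarc;
         …HurwitzMoveContract.lean p171574 ACCEPTED: the assembly + transport_dichotomy; copies in §F)
      ├ (a)  piece_a   thin tubes with the same seam (shrink + locality, DATA form)   LANDED p170665 (242)
      │        — consumed INSIDE (c₁)/(c₂) (first step of every slice construction)
      ├ (c₁) piece_c1  FREE SLICE MOVE                                               NODE  XL 1800–2600
      ├ (c₂) piece_c2  ACROSS-ONE-BELT SLICE MOVE (uses (d) at k₁ internally)         NODE  XL (c₁)+500–800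
      ├ (c₃) piece_c3_transport  Θ-compatible conjugate transport (normalisation)     PROVED here (40)
      ├ (d)  piece_d   H4's two-sided fibred belt chart (FINAL v4 text VERBATIM)      NODE (H4; bricks landed)
      ├ (e×) piece_e_cross  bridge (d) ⟹ shadow-level monodromy `HD` (N1a + homotopies) NODE  L 700–1100
      │      piece_dsh := piece_e_cross piece_d  (= hypothesis `HD` of the contract)
      └ (e)  piece_e_free  free seam transport preserves shadows (= `HE`)            LANDED p170593 (298)
             + its extended-page (w-ray) form for the bridge's step (2)              LANDED p171136 (225)
    TOTAL remaining for N1 ≈ 4.3–6.3 kLoC in three independent fronts: (c₁)∥(c₂-extra)∥((d)+(e×)).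

## The design decisions (H7), numbered for the report

(H7-1) **X-LEVEL CURRENCY OF A MOVE = the seam/belt DICHOTOMY through `G`.**  A move outputs
`(X', h', D', G)` and, instead of the seam and belt clauses through `G₀ ≫ G` (which mention `bX, Ψ`), the
two DICHOTOMY clauses `O1/O2` through `G` alone (old seam points keep their `w`-ray; old deep belt points of
handle `k` become seam points on the ray of `d k`; new deep belt points come from old seam points on the ray
of `d' k` or are old deep belt points with `d k = d' k`).  `ContractPrep.clauses_of_dichotomy` turns
`O1 ∧ O2` + the old clauses into the new clauses through `G₀ ≫ G`; conversely the new clauses force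
`O1 ∧ O2` (every boundary point of `X` is `G₀ (bX.incl y)`), so NOTHING is lost.  (W6's
`pageClause_transfer_of_dichotomy` is the `pageDir` special case of the seam half.)
(H7-2) **THE NEW CIRCLE IS DESCRIBED THROUGH `Ψ`, not through a base diffeomorphism.**  By G4 (F1)/(F2)
no base isotopy presents the move; the honest new vanishing cycle is the TRANSPORT THROUGH THE BOUNDARY OPEN
BOOK `θ_X = arg w ∘ Ψ`: push the old circle `K` off its (core) page to a seam page (`L = R₁(τ₁) ∘ K` in the
page of `d k₀ e^{iε}`), transport the seam points `y θ` (`G₀ (bX.incl (y θ)) = D.jA (a θ)`, `a θ = L θ`)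
by the RIGID page rotation `R` CONJUGATED BY `Ψ` (`Ψ (y' θ) = R_{ψ−ε} (Ψ (y θ))`), read back on the base
(`G₀ (bX.incl (y' θ)) = D.jA (a' θ)`, `L' := a'`), straighten into the flat target page (`R₃(τ₃) ∘ L'`).
This description is CHART-FREE, composes trivially, and separates cleanly: the constructions (c) realise it,
the classes follow from HOW `Ψ`-transport acts on shadows — identity on a belt-free arc ((e), PROVED:
the transported points are never deep belt points, so reading them on the base is a homotopy), the signed
transvection across one belt ((d)+(e×)).  The isotopy class of the `Ψ`-conjugated transport does not depend
on `Ψ` (two `θ_X`-transverse transports are isotopic), so (d) is well posed.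
(H7-3) **TWISTINGS ARE OUTPUTS OF (c).**  The framing of the re-dug handle is forced by `X`; its page
twisting is computed inside the dig-end model (X3-style winding computation), not transported: a Dehn twist
is not a fibred isotopy, so `pageTwisting_transport_eq_of_fibred` (p132432) does not apply across a belt, and
X3's seam-transport sign theorem is stated for `IsLefschetzLink` (standard directions) only.
(H7-4) **(a) IS A TOOL OF (c), NOT A STEP OF THE ASSEMBLY.**  With thin-tube HYPOTHESES the outputs
`h' k = h k` would be natural, but the (c)-prover must re-thin anyway (how thin depends on the slice), and
G4 (F6) forbids literal equality for fat tubes; so (c₁)/(c₂) assume nothing on tubes and output only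
"same circle and framing" for `k ≠ k₀` — all the node consumes.
(H7-5) **ONE APPLICATION, NO CHAINING.**  (c₁) (free, any `|ψ| < 2π`) and (c₂) (exactly one belt strictly
inside, any `|ψ| < 2π`) are applied ONCE for the whole angle `φ`; the only case split of the assembly is
`cross = none | some k₁` (classes by (e) resp. (d) on the sub-arc `[ε, φ]`, `ContractPrep.subarc`).
(H7-6) **WHY (c) STILL NEEDS (d) (point-set) although the contract consumes (d) only through shadows.**  In
the slab the new `jA'` is `jA ∘ m_θ` with `m_θ` the holonomy, a Dehn twist along the swept curve `c_θ`
(G4 (F2): even the free move); where `c_θ` meets `γ_{k₁}` (crossing case) `jA` is undefined and `jA'` must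
thread H4's belt chart `Λ` — so (c₂) ⇐ (d) at `k₁`, and both (c₁), (c₂) ⇐ (d) at `k₀` (absorbing the old
belt needs the structure of `θ_X` at `B_{k₀}`).  H4's COVER/IMAGE clauses are exactly what this consumes.
(H7-7) **RIGID ROTATION.**  `helper_rotFlow_page` with constant profile integrates to a GLOBAL rigid
rotation `w (R_t x) = e^{it} w x` on all of `Base g` (`rho ≤ 1/4 ≤ 3/10` everywhere) — landed as
`helper_exists_rigidRotation`; all pieces quantify over such an `R` with its four clauses.

## What is PROVED in this file / LANDED (all `--supports stmt-SmoothPoincare4-10508`, namespace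
## `…Theorems.AcyclicBisectionExists.ModpBraidOrbits`)

* `…HurwitzMoveClasses.lean`   p170593 ACCEPTED  `helper_shadow_seamTransport_free` (+ `continuousOn_invFun_range`,
  `mem_range_jA_of_rotate`, `shadow_eq_transvection_of_homotopic_twist`)                      = piece (e)
* `…HurwitzMoveClassesRay.lean` p171136 ACCEPTED `helper_shadow_seamTransport_free_ray` (the same for loops on a `w`-ray)  = piece (e), ext.
* `…HurwitzMoveModel.lean`     p170665 ACCEPTED  `helper_exists_thinData` (+ `exists_lamSq_gt_mem`, `exists_eps_family`) = piece (a)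
* `…HurwitzMoveDichotomy.lean` p170781 ACCEPTED  `helper_exists_rigidRotation`, `clauses_of_dichotomy`, `subarc`
* `…HurwitzMoveContract.lean`  p171574 ACCEPTED  `node_N1_move_of_pieces (HC1) (HC2) (HD) (HE)`, `transport_dichotomy` (= (c₃)), `helper_sameSign_of_pushoff`
CHECKED (work/stubs/scratchH7/cc_contract_chain.lean, rc 0):
`example := fun HC1 HC2 HD HE => m2geo_of_transfer (transfer_of_swap' (swap_of_move (node_N1_move_of_pieces HC1 HC2 HD HE)))`
and `node_N1_move_of_pieces HC1 HC2 HD helper_shadow_seamTransport_free` — the tree now contains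
**`stub_M2geo` modulo exactly (c₁), (c₂), (d)+(e×)**.
-/

noncomputable section

set_option linter.dupNamespace false

open scoped Manifold ContDiff Topology Real
open Set Function Metric

namespace Summit.SmoothPoincare4.SmoothPoincare4.Theorems.AcyclicBisectionExists.ModpBraidOrbits

namespace N1MoveDesign

open Literature.GroupTheory.CombinatorialGroupTheory.SignedHurwitz
open Literature.Topology.FourManifolds Literature.Topology.FourManifolds.LefschetzBase
open Literature.Topology.FourManifolds.HandleAttachingMap
open ModelsOnFibredOfReach

/-! ## §A  PIECE (a) — thin tubes with the same seam (LANDED p170665; verbatim copy) -/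

namespace PieceA

/-! ### (a).1 Compactness at the attaching sphere -/

section Compact

variable {n k : ℕ} {M : Type} [TopologicalSpace M] [ChartedSpace (EuclideanHalfSpace (n + 1)) M]

/-- **A thin tube lies in any neighbourhood of the core**: if `h̄(S) ⊆ U` with `U` open, then for
some `0 < ε ≤ 1/4` every `y ∈ T` with `|y_λ|² > 1 − 2ε` has `h̄ y ∈ U` (the continuous `|y_λ|²`
attains a maximum `< 1` on the compact set `{|y_λ|² ≥ 1/2} ∖ h̄⁻¹ U`). [folklore] -/
theorem exists_lamSq_gt_mem (f : HandleAttachingMap n k M) {U : Set M} (hU : IsOpen U)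
    (hcore : f.core ⊆ U) :
    ∃ ε : ℝ, 0 < ε ∧ ε ≤ 1 / 4 ∧ ∀ y : ↥(handleTube n k),
      1 - 2 * ε < lamSq k (((y : closedBall (0 : EuclideanSpace ℝ (Fin (n + 1))) 1) :
        EuclideanSpace ℝ (Fin (n + 1)))) → f.toFun y ∈ U := by
  set F : ↥(handleTube n k) → ℝ := fun y =>
    lamSq k (((y : closedBall (0 : EuclideanSpace ℝ (Fin (n + 1))) 1) :
      EuclideanSpace ℝ (Fin (n + 1)))) with hF
  have hFc : Continuous F := continuous_lamSq_handleTube n k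
  set V : Set ↥(handleTube n k) := f.toFun ⁻¹' U with hV
  have hVo : IsOpen V := hU.preimage f.continuous
  have hSV : ∀ y : ↥(handleTube n k), F y = 1 → y ∈ V := fun y hy =>
    hcore ⟨y, hy, rfl⟩
  set K : Set ↥(handleTube n k) := {y | (1 / 2 : ℝ) ≤ F y} with hK
  have hemb : Topology.IsEmbedding (fun y : ↥(handleTube n k) =>
      ((y : closedBall (0 : EuclideanSpace ℝ (Fin (n + 1))) 1) : EuclideanSpace ℝ (Fin (n + 1)))) :=
    Topology.IsEmbedding.subtypeVal.comp Topology.IsEmbedding.subtypeVal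
  have hKc : IsCompact K := by
    rw [hemb.isCompact_iff]
    have himg : (fun y : ↥(handleTube n k) =>
        ((y : closedBall (0 : EuclideanSpace ℝ (Fin (n + 1))) 1) : EuclideanSpace ℝ (Fin (n + 1)))) '' K =
        closedBall (0 : EuclideanSpace ℝ (Fin (n + 1))) 1 ∩ {u | (1 / 2 : ℝ) ≤ lamSq k u} := by
      ext u
      constructor
      · rintro ⟨y, hy, rfl⟩
        exact ⟨(y : closedBall (0 : EuclideanSpace ℝ (Fin (n + 1))) 1).2, hy⟩
      · rintro ⟨hu, hu'⟩
        have hu0 : lamSq k u ≠ 0 := by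
          intro h0; simp only [mem_setOf_eq, h0] at hu'; linarith
        exact ⟨⟨⟨u, hu⟩, hu0⟩, hu', rfl⟩
    rw [himg]
    exact (isCompact_closedBall _ _).inter_right (isClosed_le continuous_const (continuous_lamSq k))
  have hCc : IsCompact (K \ V) := hKc.diff hVo
  by_cases hCe : K \ V = ∅
  · refine ⟨1 / 4, by norm_num, le_rfl, fun y hy => ?_⟩
    have hyK : y ∈ K := by show (1 / 2 : ℝ) ≤ F y; change 1 - 2 * (1 / 4) < F y at hy; linarith
    by_contra hyV
    have : y ∈ K \ V := ⟨hyK, hyV⟩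
    rw [hCe] at this
    exact this
  · obtain ⟨y₀, hy₀, hmax⟩ := hCc.exists_isMaxOn (nonempty_iff_ne_empty.2 hCe) hFc.continuousOn
    have hF1 : F y₀ < 1 := by
      refine lt_of_le_of_ne (lamSq_le_one (mem_closedBall_zero_iff.1
        (y₀ : closedBall (0 : EuclideanSpace ℝ (Fin (n + 1))) 1).2)) fun h1 => hy₀.2 (hSV y₀ h1)
    refine ⟨min (1 / 4) ((1 - F y₀) / 2), lt_min (by norm_num) (by linarith), min_le_left _ _,
      fun y hy => ?_⟩
    by_contra hyV
    have hyK : y ∈ K := by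
      show (1 / 2 : ℝ) ≤ F y
      have : 1 - 2 * min (1 / 4) ((1 - F y₀) / 2) ≥ 1 / 2 := by
        have := min_le_left (1 / 4 : ℝ) ((1 - F y₀) / 2); linarith
      change 1 - 2 * min (1 / 4) ((1 - F y₀) / 2) < F y at hy
      linarith
    have hle : F y ≤ F y₀ := hmax ⟨hyK, hyV⟩
    have : 1 - 2 * min (1 / 4) ((1 - F y₀) / 2) ≥ F y₀ := by
      have := min_le_right (1 / 4 : ℝ) ((1 - F y₀) / 2); linarith
    change 1 - 2 * min (1 / 4) ((1 - F y₀) / 2) < F y at hy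
    linarith

/-- The uniform version over a finite family: one `0 < ε ≤ 1/4` for all `h̄ᵢ`. [folklore] -/
theorem exists_eps_family {m : ℕ} (f : Fin m → HandleAttachingMap n k M) (U : Fin m → Set M)
    (hU : ∀ i, IsOpen (U i)) (hcore : ∀ i, (f i).core ⊆ U i) :
    ∃ ε : ℝ, 0 < ε ∧ ε ≤ 1 / 4 ∧ ∀ (i : Fin m) (y : ↥(handleTube n k)),
      1 - 2 * ε < lamSq k (((y : closedBall (0 : EuclideanSpace ℝ (Fin (n + 1))) 1) :
        EuclideanSpace ℝ (Fin (n + 1)))) → (f i).toFun y ∈ U i := by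
  choose e he hle hmem using fun i => exists_lamSq_gt_mem (f i) (hU i) (hcore i)
  rcases Nat.eq_zero_or_pos m with rfl | hm
  · exact ⟨1 / 4, by norm_num, le_rfl, fun i => Fin.elim0 i⟩
  · haveI : Nonempty (Fin m) := ⟨⟨0, hm⟩⟩
    obtain ⟨i₀, -, hi₀⟩ := Finset.exists_min_image Finset.univ e Finset.univ_nonempty
    refine ⟨e i₀, he i₀, hle i₀, fun i y hy => hmem i y ?_⟩
    have := hi₀ i (Finset.mem_univ i)
    linarith

end Compact

/-! ### (a).2 Thin data with the same seam -/

section Thin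

variable {g n : ℕ} {h : Fin n → HandleAttachingMap 3 2 (Base g)}
  {X : Type} [TopologicalSpace X] [ChartedSpace (EuclideanHalfSpace 4) X] [IsManifold (𝓡∂ 4) ∞ X]

/-- **Thin data with the same seam** (piece (a) of the N1 contract).  For every family of open
sets `U k ⊇ (h k).core` there are attaching maps `h' k` (the shrunken maps `(h k).shrink`) and a
datum `D'` of the SAME `X` with: thin tubes `range (h' k).toFun ⊆ U k`; the same attaching circles,
handle framings and cores; `D'.jA a' = D.jA a` whenever `a' = a` as points of `Base g`;
`range D'.jA = range D.jA`; and `D'.jB k b = D.jB k b` at every deep point `D'.jB k b ∉ range D'.jA`.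
(The new handle embeddings are `LocalityData.jB'`: `D.jB k` near the belt disc, `D.jA ∘ h̄ₖ ∘ α`
elsewhere.) [cite: Kosinski1993, VI §6 with VI §1 (proof of (1.1))] -/
theorem exists_thinData (D : MultiAttachmentData h (𝓡∂ 4) X) (U : Fin n → Set (Base g))
    (hU : ∀ k, IsOpen (U k)) (hcore : ∀ k, (h k).core ⊆ U k) :
    ∃ (h' : Fin n → HandleAttachingMap 3 2 (Base g)) (D' : MultiAttachmentData h' (𝓡∂ 4) X),
      (∀ k, range (h' k).toFun ⊆ U k) ∧
      (∀ k, (h' k).attachingCircle = (h k).attachingCircle) ∧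
      (∀ k, (h' k).attachingFraming = (h k).attachingFraming) ∧
      (∀ k, (h' k).core = (h k).core) ∧
      (∀ (a' : ↥(coresComplement h')) (a : ↥(coresComplement h)), (a' : Base g) = a →
        D'.jA a' = D.jA a) ∧
      range D'.jA = range D.jA ∧
      (∀ k b, D'.jB k b ∉ range D'.jA → D'.jB k b = D.jB k b) := by
  -- the tube `T ⊆ D⁴` is non-empty (it contains the attaching circle): needed by `shrink`
  haveI : Nonempty ↥(handleTube 3 2) := ⟨coreTubePt (circlePt 0)⟩
  obtain ⟨ε, hε, hε4, hmem⟩ := exists_eps_family h U hU hcore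
  have hε2 : 2 * ε ≤ 1 := by linarith
  -- the shrunken family and the locality datum
  set h' : Fin n → HandleAttachingMap 3 2 (Base g) := fun k => (h k).shrink hε hε2 with hh'
  have heq : ∀ (k : Fin n) (y : ↥(handleTube 3 2)),
      1 - ε < lamSq 2 (((y : closedBall (0 : EuclideanSpace ℝ (Fin 4)) 1) : EuclideanSpace ℝ (Fin 4))) →
      (h k).toFun y = (h' k).toFun y :=
    fun k y hy => ((h k).shrink_apply_of_lt hε hε2 hy).symm
  let L : LocalityData h h' X :=
    { ε := ε, ε_pos := hε, eqOn := heq,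
      disjoint := pairwise_disjoint_range_shrink hε hε2 D.disjoint, disjointG := D.disjoint,
      jA := D.jA, jB := D.jB, hjA := D.hjA, hjAo := D.hjAo, hjB := D.hjB, cover := D.cover,
      glue := D.glue, disjointB := D.disjointB }
  have hr : range (L.jA ∘ L.ccCongr) = range D.jA := L.ccCongr.surjective.range_comp _
  let D' : MultiAttachmentData h' (𝓡∂ 4) X :=
    { disjoint := L.disjoint
      jA := L.jA ∘ L.ccCongr
      jB := L.jB'
      hjA := L.hjA.comp_openPartialHomeomorph L.ccCongr.toHomeomorph.toOpenPartialHomeomorph rfl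
        (L.ccCongr.contMDiff.contMDiffOn.congr fun _ _ => rfl)
        (L.ccCongr.symm.contMDiff.contMDiffOn.congr fun _ _ => rfl)
      hjAo := by rw [hr]; exact D.hjAo
      hjB := L.isSmoothEmbedding_jB'
      cover := L.cover'
      glue := L.jA_eq_jB'_iff
      disjointB := L.disjointB' }
  refine ⟨h', D', fun k => ?_, fun k => ?_, fun k => ?_, fun k => (h k).core_shrink hε hε2, ?_, hr,
    fun k b hb => ?_⟩
  · -- thin tubes
    refine ((h k).range_shrink_subset hε hε2).trans ?_
    rintro _ ⟨y, hy, rfl⟩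
    exact hmem k y hy
  · -- same attaching circle
    funext θ
    exact (h k).shrink_apply_of_eq_one hε hε2 (lamSq_corePt θ)
  · -- same handle framing: the maps agree near the attaching sphere
    funext θ
    have hev : (h' k).toFun =ᶠ[𝓝 (coreTubePt θ)] (h k).toFun := by
      have ho : IsOpen {y : ↥(handleTube 3 2) | 1 - ε <
          lamSq 2 (((y : closedBall (0 : EuclideanSpace ℝ (Fin 4)) 1) : EuclideanSpace ℝ (Fin 4)))} :=
        isOpen_lt continuous_const (continuous_lamSq_handleTube 3 2)
      have hmem0 : coreTubePt θ ∈ {y : ↥(handleTube 3 2) | 1 - ε <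
          lamSq 2 (((y : closedBall (0 : EuclideanSpace ℝ (Fin 4)) 1) : EuclideanSpace ℝ (Fin 4)))} := by
        show 1 - ε < lamSq 2 (corePt θ)
        rw [lamSq_corePt]; linarith
      filter_upwards [ho.mem_nhds hmem0] with y hy
      exact (heq k y hy).symm
    show mfderiv (𝓡∂ 4) (𝓡∂ 4) (h' k).toFun (coreTubePt θ) _ =
      mfderiv (𝓡∂ 4) (𝓡∂ 4) (h k).toFun (coreTubePt θ) _
    rw [hev.mfderiv_eq]
    rfl
  · -- same `jA` on the common complement of the cores
    intro a' a he
    show D.jA (L.ccCongr a') = D.jA a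
    congr 1
    exact Subtype.ext he
  · -- deep points of the new handles are the old ones
    by_cases hb0 : lamSq 2 (((b : closedBall (0 : EuclideanSpace ℝ (Fin 4)) 1) : EuclideanSpace ℝ (Fin 4))) = 0
    · exact L.jB'_of_lt k (by rw [hb0]; exact hε)
    · exfalso
      refine hb ?_
      show L.jB' k b ∈ range (L.jA ∘ L.ccCongr)
      rw [hr, L.jB'_of_ne_zero k hb0]
      exact mem_range_self _

end Thin

end PieceA

open PieceA

/-! ### (a) as consumed (the landed `helper_exists_thinData`, p170665) -/

/-- **PIECE (a) — thin tubes with the same seam** (LANDED as `helper_exists_thinData`,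
`…HurwitzMoveModel.lean`, p170665 ACCEPTED; this is a verbatim copy, the module being built on the farm at
the time of writing): see `PieceA.exists_thinData`.  Consumed INSIDE (c₁)/(c₂) (first step of every slice
construction: make all tubes thin, G4 (F6)).
[cite: Kosinski1993, VI §6 with VI §1 (proof of (1.1))] -/
theorem piece_a : ∀ (g n : ℕ) (h : Fin n → Literature.Topology.FourManifolds.HandleAttachingMap 3 2 (Literature.Topology.FourManifolds.LefschetzBase.Base g)) (X : Type) [TopologicalSpace X] [ChartedSpace (EuclideanHalfSpace 4) X] [IsManifold (𝓡∂ 4) ∞ X] (D : Literature.Topology.FourManifolds.HandleAttachingMap.MultiAttachmentData h (𝓡∂ 4) X) (U : Fin n → Set (Literature.Topology.FourManifolds.LefschetzBase.Base g)), (∀ k, IsOpen (U k)) → (∀ k, (h k).core ⊆ U k) → ∃ (h' : Fin n → Literature.Topology.FourManifolds.HandleAttachingMap 3 2 (Literature.Topology.FourManifolds.LefschetzBase.Base g)) (D' : Literature.Topology.FourManifolds.HandleAttachingMap.MultiAttachmentData h' (𝓡∂ 4) X), (∀ k, Set.range (h' k).toFun ⊆ U k) ∧ (∀ k, (h' k).attachingCircle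 = (h k).attachingCircle) ∧ (∀ k, (h' k).attachingFraming = (h k).attachingFraming) ∧ (∀ k, (h' k).core = (h k).core) ∧ (∀ (a' : ↥(Literature.Topology.FourManifolds.HandleAttachingMap.coresComplement h')) (a : ↥(Literature.Topology.FourManifolds.HandleAttachingMap.coresComplement h)), (a' : Literature.Topology.FourManifolds.LefschetzBase.Base g) = a → D'.jA a' = D.jA a) ∧ Set.range D'.jA = Set.range D.jA ∧ (∀ k b, D'.jB k b ∉ Set.range D'.jA → D'.jB k b = D.jB k b) :=
  fun _ _ _ _ _ _ _ D U hU hcore => exists_thinData D U hU hcore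


section PieceADichotomy

variable {g n : ℕ} {h h' : Fin n → HandleAttachingMap 3 2 (Base g)}
  {X : Type} [TopologicalSpace X] [ChartedSpace (EuclideanHalfSpace 4) X]

/-- **How (c)-provers use (a): the thinned datum satisfies the seam/belt DICHOTOMY of the contract with
`G = refl` and unchanged directions** (from the exported trace of `piece_a`: same cores, same `jA` on the
common complement, same range of `jA`, same deep `jB`) — so by `ContractPrep.clauses_of_dichotomy` the
seam and belt clauses through `G₀` survive thinning, and moves compose with it for free. [folklore] -/
theorem piece_a_dichotomy (D : MultiAttachmentData h (𝓡∂ 4) X) (D' : MultiAttachmentData h' (𝓡∂ 4) X)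
    (d : Fin n → ℂ) (hcore : ∀ k, (h' k).core = (h k).core)
    (hjA : ∀ (a' : ↥(coresComplement h')) (a : ↥(coresComplement h)), (a' : Base g) = a → D'.jA a' = D.jA a)
    (hr : range D'.jA = range D.jA) (hjB : ∀ k b, D'.jB k b ∉ range D'.jA → D'.jB k b = D.jB k b) :
    (∀ a' : ↥(coresComplement h'),
      (Diffeomorph.refl (𝓡∂ 4) X ∞).symm (D'.jA a') ∈ (𝓡∂ 4).boundary X →
      (∃ a : ↥(coresComplement h), (Diffeomorph.refl (𝓡∂ 4) X ∞).symm (D'.jA a') = D.jA a ∧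
        ∃ c : ℝ, 0 < c ∧ w g (a' : Base g).1 = (c : ℂ) * w g (a : Base g).1) ∨
      (∃ (k : Fin n) (b : ↥(beltPiece 3 2)), (Diffeomorph.refl (𝓡∂ 4) X ∞).symm (D'.jA a') = D.jB k b ∧
        (Diffeomorph.refl (𝓡∂ 4) X ∞).symm (D'.jA a') ∉ range D.jA ∧
        ∃ c : ℝ, 0 < c ∧ w g (a' : Base g).1 = (c : ℂ) * d k)) ∧
    (∀ (k' : Fin n) (b' : ↥(beltPiece 3 2)), D'.jB k' b' ∉ range D'.jA →
      (Diffeomorph.refl (𝓡∂ 4) X ∞).symm (D'.jB k' b') ∈ (𝓡∂ 4).boundary X →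
      (∃ a : ↥(coresComplement h), (Diffeomorph.refl (𝓡∂ 4) X ∞).symm (D'.jB k' b') = D.jA a ∧
        ∃ c : ℝ, 0 < c ∧ w g (a : Base g).1 = (c : ℂ) * d k') ∨
      (∃ (k : Fin n) (b : ↥(beltPiece 3 2)), (Diffeomorph.refl (𝓡∂ 4) X ∞).symm (D'.jB k' b') = D.jB k b ∧
        (Diffeomorph.refl (𝓡∂ 4) X ∞).symm (D'.jB k' b') ∉ range D.jA ∧ d k = d k')) := by
  constructor
  · intro a' _
    have ha : (a' : Base g) ∈ coresComplement h := by
      have h2 := a'.2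
      simp only [mem_coresComplement] at h2 ⊢
      intro k; rw [← hcore k]; exact h2 k
    exact Or.inl ⟨⟨a', ha⟩, hjA a' ⟨a', ha⟩ rfl, 1, one_pos, by push_cast; ring⟩
  · intro k' b' hdeep _
    refine Or.inr ⟨k', b', hjB k' b' hdeep, ?_, rfl⟩
    show D'.jB k' b' ∉ range D.jA
    rw [← hr]; exact hdeep

end PieceADichotomy

/-! ## §C  PIECES (c₁), (c₂), (c₃) — the slice constructions (statement level; (c₃) PROVED) -/

/-- **PIECE (c₁) — THE FREE SLICE MOVE** (NODE, the first hypothesis `HC1` of the landed contract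
`node_N1_move_of_pieces`).  INPUT: the fibred datum of `node_N1_move` (`X₀, bX, Ψ, X, G₀, h, D`, unit
directions `d`, cores in the flat pages, the seam and belt clauses through `G₀`), the handle `k₀`, a signed
angle `ψ` (`0 < |ψ| < 2π`), the RIGID page rotation `R` (`rho`, flat part, `w ∘ R_t = e^{it} w`, flow law —
`ContractPrep.exists_rigidRotation`), and FREENESS: no other core direction on the closed swept arc
`d k₀ e^{itψ}`, `t ∈ [0,1]`.  OUTPUT: `X'` (with its six instances), `h'`, `D'`, `G : X ≅ X'`, isotopies
`R₁, R₃` with stages `τ₁, τ₃`, the push-off angle `ε` (`0 < ε/ψ < 1`), loops `L, L'` with their seam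
presentations `y, a, y', a'`, such that: `L = R₁(τ₁) ∘ K` (`K` the old circle of `k₀`) lies in the flat page
of `d k₀ e^{iε}`; `L'` is the RIGID SEAM TRANSPORT of `L` through `Ψ` by the angle `ψ − ε`
(`Ψ (y' θ) = R_{ψ−ε} (Ψ (y θ))`, read back on the base: `G₀ (bX.incl (y' θ)) = D.jA (a' θ)`, `a' θ = L' θ`);
the new circle of `k₀` is `R₃(τ₃) ∘ L'` and lies in the flat page of `d k₀ e^{iψ}`; circles and framings of
the other handles unchanged; the page twisting of `k₀` unchanged; and the SEAM/BELT DICHOTOMY of `(h', D')`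
through `G` (old seam points keep their `w`-ray, old deep belt points of handle `k` become seam points on the
ray of `d k`; new deep belt points come from old seam points on the ray of the UPDATED direction or are old
deep belt points of a handle with the same direction).  INTERNAL PLAN (G4 (F1)–(F3), H7 analysis):
(i) thin all tubes (`piece_a`); (ii) ABSORB the old handle: near `γ × {θ₀}` the new `jA'` covers the old
deep belt `B_{k₀}` by plain base points (needs the point-set structure of `θ_X` at `B_{k₀}` = H4's belt chart
`helper_N1_beltMonodromy` at `k₀`); (iii) in the middle of the slab `jA' = jA ∘ m_θ`, `m_θ` a page-diffeo
family realising the holonomy (a Dehn twist along the swept curve `c_θ`, supported near it; G4 (F2)), chosen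
`= id` near the pages of the other handles; (iv) DIG the new handle at `R₃(τ₃) L' × {θ₀+ψ}`: new `jB'_{k₀}`
through the old handle chart `D.jB k₀` near the centre (the new cocore meets the old core and cocore in the
centre only), new tube `h' k₀` around the straightened curve (`helper_strFlow_page`), its page twisting
computed (X3-style, `wind_eq_of_pointwise_frame`); (v) normalise the target circle to the literal
`R₃(τ₃) ∘ L'` by a fibred conjugation (`piece_c3_transport`).  SIZE (honest): XL, 1800–2600 lines
((ii)+(iv) end models 900–1300, (iii) 300–500, twisting 300–500, plumbing 300).
[cite: GompfStipsicz1999, §8.2] -/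
theorem piece_c1 : ∀ (g n : ℕ) (X₀ : Type) [TopologicalSpace X₀] [T2Space X₀] [SecondCountableTopology X₀] [CompactSpace X₀] [ChartedSpace (EuclideanHalfSpace 4) X₀] [IsManifold (𝓡∂ 4) ∞ X₀] (bX : BoundaryData (𝓡∂ 4) X₀ (𝓡 3)) (Ψ : bX.carrier ≃ₘ⟮𝓡 3, 𝓡 3⟯ (bBase g).carrier) (X : Type) [TopologicalSpace X] [T2Space X] [SecondCountableTopology X] [CompactSpace X] [ChartedSpace (EuclideanHalfSpace 4) X] [IsManifold (𝓡∂ 4) ∞ X] (G₀ : X₀ ≃ₘ⟮𝓡∂ 4, 𝓡∂ 4⟯ X) (h : Fin n → HandleAttachingMap 3 2 (Base g)) (D : MultiAttachmentData h (𝓡∂ 4) X) (d : Fin n → ℂ), (∀ k, ‖d k‖ = 1) → (∀ k θ, (h k).attachingCircle θ ∈ page g (d k)) → (∀ (y : bX.carrier) (a : ↥(coresComplement h)), G₀ (bX.incl y) = D.jA a → ∃ c : ℝ, 0 < c ∧ w g ((bBase g).incl (Ψ y)).1 = (c : ℂ) * w g (a : Base g).1) → (∀ (y : bX.carrier) (k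 : Fin n) (b : ↥(beltPiece 3 2)), G₀ (bX.incl y) = D.jB k b → G₀ (bX.incl y) ∉ range D.jA → ∃ c : ℝ, 0 < c ∧ w g ((bBase g).incl (Ψ y)).1 = (c : ℂ) * d k) → ∀ (k₀ : Fin n) (ψ : ℝ) (R : AmbientIsotopy (𝓡∂ 4) (Base g)), ψ ≠ 0 → |ψ| < 2 * π → (∀ (t : ℝ) (x : Base g), rho g (R.toFun t x).1 = rho g x.1) → (∀ (t : ℝ) (x : Base g), w g (R.toFun t x).1 = Complex.exp ((t : ℂ) * Complex.I) * w g x.1) → (∀ (t : ℝ) (x : Base g), ‖cx (R.toFun t x).1‖ ^ 2 < 4 ↔ ‖cx x.1‖ ^ 2 < 4) → (∀ (t t' : ℝ) (x : Base g), R.toFun t (R.toFun t' x) = R.toFun (t + t') x) → (∀ k, k ≠ k₀ → ∀ t ∈ Set.Icc (0 : ℝ) 1, d k ≠ d k₀ * Complex.exp (((t * ψ : ℝ) : ℂ) * Complex.I)) → ∃ (X' : Type) (_ : TopologicalSpace X') (_ : T2Space X') (_ : SecondCountableTopology X') (_ : CompactSpace X') (_ : ChartedSpace (EuclideanHalfSpace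 4) X') (_ : IsManifold (𝓡∂ 4) ∞ X') (h' : Fin n → HandleAttachingMap 3 2 (Base g)) (D' : MultiAttachmentData h' (𝓡∂ 4) X') (G : X ≃ₘ⟮𝓡∂ 4, 𝓡∂ 4⟯ X') (R₁ R₃ : AmbientIsotopy (𝓡∂ 4) (Base g)) (τ₁ τ₃ ε : ℝ) (L L' : Metric.sphere (0 : EuclideanSpace ℝ (Fin 2)) 1 → Base g) (y y' : Metric.sphere (0 : EuclideanSpace ℝ (Fin 2)) 1 → bX.carrier) (a a' : Metric.sphere (0 : EuclideanSpace ℝ (Fin 2)) 1 → ↥(coresComplement h)), (0 < ε / ψ ∧ ε / ψ < 1) ∧ Continuous L ∧ Continuous L' ∧ (∀ θ, L θ = R₁.toFun τ₁ ((h k₀).attachingCircle θ)) ∧ (∀ θ, L θ ∈ page g (d k₀ * Complex.exp ((ε : ℂ) * Complex.I))) ∧ (∀ θ, G₀ (bX.incl (y θ)) = D.jA (a θ)) ∧ (∀ θ, ((a θ : ↥(coresComplement h)) : Base g) = L θ) ∧ (∀ θ, (bBase g).incl (Ψ (y' θ)) = R.toFun (ψ - ε) ((bBase g).incl (Ψ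 (y θ)))) ∧ (∀ θ, G₀ (bX.incl (y' θ)) = D.jA (a' θ)) ∧ (∀ θ, ((a' θ : ↥(coresComplement h)) : Base g) = L' θ) ∧ (∀ θ, (h' k₀).attachingCircle θ = R₃.toFun τ₃ (L' θ)) ∧ (∀ θ, (h' k₀).attachingCircle θ ∈ page g (d k₀ * Complex.exp ((ψ : ℂ) * Complex.I))) ∧ (∀ k, k ≠ k₀ → (h' k).attachingCircle = (h k).attachingCircle ∧ (h' k).attachingFraming = (h k).attachingFraming) ∧ pageTwisting g (h' k₀).attachingCircle (h' k₀).attachingFraming = pageTwisting g (h k₀).attachingCircle (h k₀).attachingFraming ∧ (∀ a' : ↥(coresComplement h'), G.symm (D'.jA a') ∈ (𝓡∂ 4).boundary X → (∃ a : ↥(coresComplement h), G.symm (D'.jA a') = D.jA a ∧ ∃ c : ℝ, 0 < c ∧ w g (a' : Base g).1 = (c : ℂ) * w g (a : Base g).1) ∨ (∃ (k : Fin n) (b : ↥(beltPiece 3 2)), G.symm (D'.jA a') = D.jB k b ∧ G.symm (D'.jA a') ∉ range D.jA ∧ ∃ c : ℝ, 0 < c ∧ w g (a' : Base g).1 = (c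 : ℂ) * d k)) ∧ (∀ (k' : Fin n) (b' : ↥(beltPiece 3 2)), D'.jB k' b' ∉ range D'.jA → G.symm (D'.jB k' b') ∈ (𝓡∂ 4).boundary X → (∃ a : ↥(coresComplement h), G.symm (D'.jB k' b') = D.jA a ∧ ∃ c : ℝ, 0 < c ∧ w g (a : Base g).1 = (c : ℂ) * Function.update d k₀ (d k₀ * Complex.exp ((ψ : ℂ) * Complex.I)) k') ∨ (∃ (k : Fin n) (b : ↥(beltPiece 3 2)), G.symm (D'.jB k' b') = D.jB k b ∧ G.symm (D'.jB k' b') ∉ range D.jA ∧ d k = Function.update d k₀ (d k₀ * Complex.exp ((ψ : ℂ) * Complex.I)) k')) := by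
  sorry

/-- **PIECE (c₂) — THE ACROSS-ONE-BELT SLICE MOVE** (NODE, hypothesis `HC2` of the contract).  As (c₁),
with ONE crossed handle `k₁ ≠ k₀` strictly inside the swept arc (`d k₁ = d k₀ e^{itψ}`, `t ∈ (0,1)`) and no
other core direction on the closed arc; the extra output `d k₁ = d k₀ e^{iε} e^{it(ψ−ε)}`, `t ∈ (0,1)` (the
push-off stops before the crossed handle).  The new circle is again `R₃(τ₃) ∘ L'` with `L'` the rigid seam
transport of the push-off `L` through `Ψ` ACROSS the belt page angle of `k₁` — the Picard–Lefschetz twist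
is carried by `Ψ`, not asserted here (its effect on shadows is piece (d)); the page twisting of `k₀` is an
OUTPUT (the framing of the re-dug handle is forced by `X`).  INTERNAL PLAN: (c₁)'s (i)–(v) plus (iii′) the
passage of the twist family `m_θ` through the belt chart of `k₁` (the swept curve meets `γ_{k₁}`; there
`jA'` threads the two-sided fibred belt chart `Λ` of H4's `helper_N1_beltMonodromy` at `k₁`: BELOW plain,
ABOVE composed with the return map `G`).  SIZE (honest): XL, (c₁) + 500–800 lines for (iii′).
[cite: GompfStipsicz1999, §8.2] -/
theorem piece_c2 : ∀ (g n : ℕ) (X₀ : Type) [TopologicalSpace X₀] [T2Space X₀] [SecondCountableTopology X₀] [CompactSpace X₀] [ChartedSpace (EuclideanHalfSpace 4) X₀] [IsManifold (𝓡∂ 4) ∞ X₀] (bX : BoundaryData (𝓡∂ 4) X₀ (𝓡 3)) (Ψ : bX.carrier ≃ₘ⟮𝓡 3, 𝓡 3⟯ (bBase g).carrier) (X : Type) [TopologicalSpace X] [T2Space X] [SecondCountableTopology X] [CompactSpace X] [ChartedSpace (EuclideanHalfSpace 4) X] [IsManifold (𝓡∂ 4) ∞ X] (G₀ : X₀ ≃ₘ⟮𝓡∂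 4, 𝓡∂ 4⟯ X) (h : Fin n → HandleAttachingMap 3 2 (Base g)) (D : MultiAttachmentData h (𝓡∂ 4) X) (d : Fin n → ℂ), (∀ k, ‖d k‖ = 1) → (∀ k θ, (h k).attachingCircle θ ∈ page g (d k)) → (∀ (y : bX.carrier) (a : ↥(coresComplement h)), G₀ (bX.incl y) = D.jA a → ∃ c : ℝ, 0 < c ∧ w g ((bBase g).incl (Ψ y)).1 = (c : ℂ) * w g (a : Base g).1) → (∀ (y : bX.carrier) (k : Fin n) (b : ↥(beltPiece 3 2)), G₀ (bX.incl y) = D.jB k b → G₀ (bX.incl y) ∉ range D.jA → ∃ c : ℝ, 0 < c ∧ w g ((bBase g).incl (Ψ y)).1 = (c : ℂ) * d k) → ∀ (k₀ k₁ : Fin n) (ψ : ℝ) (R : AmbientIsotopy (𝓡∂ 4) (Base g)), k₁ ≠ k₀ → ψ ≠ 0 → |ψ| < 2 * π → (∀ (t : ℝ) (x : Base g), rho g (R.toFun t x).1 = rho g x.1) → (∀ (t : ℝ) (x : Base g), w g (R.toFun t x).1 = Complex.exp ((t : ℂ) * Complex.I) * w g x.1) → (∀ (t : ℝ) (x : Base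 g), ‖cx (R.toFun t x).1‖ ^ 2 < 4 ↔ ‖cx x.1‖ ^ 2 < 4) → (∀ (t t' : ℝ) (x : Base g), R.toFun t (R.toFun t' x) = R.toFun (t + t') x) → (∃ t ∈ Set.Ioo (0 : ℝ) 1, d k₁ = d k₀ * Complex.exp (((t * ψ : ℝ) : ℂ) * Complex.I)) → (∀ k, k ≠ k₀ → k ≠ k₁ → ∀ t ∈ Set.Icc (0 : ℝ) 1, d k ≠ d k₀ * Complex.exp (((t * ψ : ℝ) : ℂ) * Complex.I)) → ∃ (X' : Type) (_ : TopologicalSpace X') (_ : T2Space X') (_ : SecondCountableTopology X') (_ : CompactSpace X') (_ : ChartedSpace (EuclideanHalfSpace 4) X') (_ : IsManifold (𝓡∂ 4) ∞ X') (h' : Fin n → HandleAttachingMap 3 2 (Base g)) (D' : MultiAttachmentData h' (𝓡∂ 4) X') (G : X ≃ₘ⟮𝓡∂ 4, 𝓡∂ 4⟯ X') (R₁ R₃ : AmbientIsotopy (𝓡∂ 4) (Base g)) (τ₁ τ₃ ε : ℝ) (L L' : Metric.sphere (0 : EuclideanSpace ℝ (Fin 2)) 1 → Base g) (y y' : Metric.sphere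 (0 : EuclideanSpace ℝ (Fin 2)) 1 → bX.carrier) (a a' : Metric.sphere (0 : EuclideanSpace ℝ (Fin 2)) 1 → ↥(coresComplement h)), (0 < ε / ψ ∧ ε / ψ < 1) ∧ (∃ t ∈ Set.Ioo (0 : ℝ) 1, d k₁ = d k₀ * Complex.exp ((ε : ℂ) * Complex.I) * Complex.exp (((t * (ψ - ε) : ℝ) : ℂ) * Complex.I)) ∧ Continuous L ∧ Continuous L' ∧ (∀ θ, L θ = R₁.toFun τ₁ ((h k₀).attachingCircle θ)) ∧ (∀ θ, L θ ∈ page g (d k₀ * Complex.exp ((ε : ℂ) * Complex.I))) ∧ (∀ θ, G₀ (bX.incl (y θ)) = D.jA (a θ)) ∧ (∀ θ, ((a θ : ↥(coresComplement h)) : Base g) = L θ) ∧ (∀ θ, (bBase g).incl (Ψ (y' θ)) = R.toFun (ψ - ε) ((bBase g).incl (Ψ (y θ)))) ∧ (∀ θ, G₀ (bX.incl (y' θ)) = D.jA (a' θ)) ∧ (∀ θ, ((a' θ : ↥(coresComplement h)) : Base g) = L' θ) ∧ (∀ θ, (h' k₀).attachingCircle θ = R₃.toFun τ₃ (L' θ))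 ∧ (∀ θ, (h' k₀).attachingCircle θ ∈ page g (d k₀ * Complex.exp ((ψ : ℂ) * Complex.I))) ∧ (∀ k, k ≠ k₀ → (h' k).attachingCircle = (h k).attachingCircle ∧ (h' k).attachingFraming = (h k).attachingFraming) ∧ pageTwisting g (h' k₀).attachingCircle (h' k₀).attachingFraming = pageTwisting g (h k₀).attachingCircle (h k₀).attachingFraming ∧ (∀ a' : ↥(coresComplement h'), G.symm (D'.jA a') ∈ (𝓡∂ 4).boundary X → (∃ a : ↥(coresComplement h), G.symm (D'.jA a') = D.jA a ∧ ∃ c : ℝ, 0 < c ∧ w g (a' : Base g).1 = (c : ℂ) * w g (a : Base g).1) ∨ (∃ (k : Fin n) (b : ↥(beltPiece 3 2)), G.symm (D'.jA a') = D.jB k b ∧ G.symm (D'.jA a') ∉ range D.jA ∧ ∃ c : ℝ, 0 < c ∧ w g (a' : Base g).1 = (c : ℂ) * d k)) ∧ (∀ (k' : Fin n) (b' : ↥(beltPiece 3 2)), D'.jB k' b' ∉ range D'.jA → G.symm (D'.jB k' b') ∈ (𝓡∂ 4).boundary X → (∃ a : ↥(coresComplement h), G.symm (D'.jB k' b') =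 D.jA a ∧ ∃ c : ℝ, 0 < c ∧ w g (a : Base g).1 = (c : ℂ) * Function.update d k₀ (d k₀ * Complex.exp ((ψ : ℂ) * Complex.I)) k') ∨ (∃ (k : Fin n) (b : ↥(beltPiece 3 2)), G.symm (D'.jB k' b') = D.jB k b ∧ G.symm (D'.jB k' b') ∉ range D.jA ∧ d k = Function.update d k₀ (d k₀ * Complex.exp ((ψ : ℂ) * Complex.I)) k')) := by
  sorry

section PieceC3

variable {g n : ℕ} {h : Fin n → HandleAttachingMap 3 2 (Base g)}
  {X : Type} [TopologicalSpace X] [ChartedSpace (EuclideanHalfSpace 4) X]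

/-- **PIECE (c₃) — Θ-compatible CONJUGATE TRANSPORT along an angle-preserving base diffeomorphism**
(PROVED; LANDED as `transport_dichotomy` in `…HurwitzMoveContract.lean`; the normalisation step (v) of
(c₁)/(c₂), and G4's "model replacement" in data form): for a
diffeomorphism `J` of `Base g` preserving every `w`-ray (`w (J x) ∈ ℝ_{>0} w x`), the tree's transported
datum `D.transport J` of the SAME `X` along the family `(h k).transport J` satisfies the seam/belt dichotomy
of the contract with `G = refl` and unchanged directions: every new seam point is the old seam point
`J⁻¹ a'` on the same ray, every new deep belt point is an old deep belt point of the same handle.  (By G4's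
finding (F1) this is ALL a conjugate-type transport can do: it never moves a handle to another page.)
[cite: Kosinski1993, VI §6 and VIII proof of (1.2)] -/
theorem piece_c3_transport (D : MultiAttachmentData h (𝓡∂ 4) X) (J : Base g ≃ₘ⟮𝓡∂ 4, 𝓡∂ 4⟯ Base g)
    (hJ : ∀ x : Base g, ∃ r : ℝ, 0 < r ∧ w g (J x).1 = (r : ℂ) * w g x.1) (d : Fin n → ℂ) :
    (∀ a' : ↥(coresComplement fun k => (h k).transport J),
      (Diffeomorph.refl (𝓡∂ 4) X ∞).symm ((D.transport J).jA a') ∈ (𝓡∂ 4).boundary X →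
      (∃ a : ↥(coresComplement h), (Diffeomorph.refl (𝓡∂ 4) X ∞).symm ((D.transport J).jA a') = D.jA a ∧
        ∃ c : ℝ, 0 < c ∧ w g (a' : Base g).1 = (c : ℂ) * w g (a : Base g).1) ∨
      (∃ (k : Fin n) (b : ↥(beltPiece 3 2)),
        (Diffeomorph.refl (𝓡∂ 4) X ∞).symm ((D.transport J).jA a') = D.jB k b ∧
        (Diffeomorph.refl (𝓡∂ 4) X ∞).symm ((D.transport J).jA a') ∉ range D.jA ∧
        ∃ c : ℝ, 0 < c ∧ w g (a' : Base g).1 = (c : ℂ) * d k)) ∧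
    (∀ (k' : Fin n) (b' : ↥(beltPiece 3 2)), (D.transport J).jB k' b' ∉ range (D.transport J).jA →
      (Diffeomorph.refl (𝓡∂ 4) X ∞).symm ((D.transport J).jB k' b') ∈ (𝓡∂ 4).boundary X →
      (∃ a : ↥(coresComplement h), (Diffeomorph.refl (𝓡∂ 4) X ∞).symm ((D.transport J).jB k' b') = D.jA a ∧
        ∃ c : ℝ, 0 < c ∧ w g (a : Base g).1 = (c : ℂ) * d k') ∨
      (∃ (k : Fin n) (b : ↥(beltPiece 3 2)),
        (Diffeomorph.refl (𝓡∂ 4) X ∞).symm ((D.transport J).jB k' b') = D.jB k b ∧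
        (Diffeomorph.refl (𝓡∂ 4) X ∞).symm ((D.transport J).jB k' b') ∉ range D.jA ∧ d k = d k')) := by
  have hr : range (D.transport J).jA = range D.jA :=
    (coresComplementCongr h J).surjective.range_comp D.jA
  constructor
  · intro a' _
    left
    refine ⟨coresComplementCongr h J a', rfl, ?_⟩
    obtain ⟨r, hr0, hw⟩ := hJ (J.symm (a' : Base g))
    rw [Diffeomorph.apply_symm_apply] at hw
    exact ⟨r, hr0, hw⟩
  · intro k' b' hdeep _
    right
    refine ⟨k', b', rfl, ?_, rfl⟩
    show D.jB k' b' ∉ range D.jA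
    rw [← hr]; exact hdeep

end PieceC3

/-! ## §D  PIECE (d) — the deep-belt monodromy model (H4) and its shadow-level form consumed here -/

/-- **PIECE (d) — N1-mono, H4's FINAL v4 text VERBATIM** (`work/stubs/H4H7_interface.lean`,
`H4Interface.N1MonoStatement`; to be landed by H4 as `helper_N1_beltMonodromy`; H4's bricks H4-1/1′/1″
LANDED: `…BeltMonodromyModel.lean`, `…BeltMonodromyPages.lean`, …): around the deep belt circle of ONE
handle `k`, given the consumer's fibred family `φ` of annulus charts of the pages `d k e^{iσ}`, a TWO-SIDED
FIBRED BELT CHART `Λ : ℝ × ℝ × ℝ → ∂X₀` of `θ_X = arg w ∘ Ψ` with: FIBRED levels; BELOW the belt page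
angle and on the SIDES plain seam points in the chart coordinates; ABOVE plain seam points in the chart
coordinates COMPOSED WITH A RETURN MAP `G` of total displacement `+1` (`s = true`, right-handed) resp.
`−1`; IMAGE and COVER clauses (the dichotomy (c₂) consumes).  NODE here (H4's). [cite: GompfStipsicz1999, §8.2] -/
theorem piece_d :
  ∀ (g n : ℕ) (X₀ : Type) [TopologicalSpace X₀] [T2Space X₀] [SecondCountableTopology X₀]
    [CompactSpace X₀] [ChartedSpace (EuclideanHalfSpace 4) X₀] [IsManifold (𝓡∂ 4) ∞ X₀]
    (bX : BoundaryData (𝓡∂ 4) X₀ (𝓡 3)) (Ψ : bX.carrier ≃ₘ⟮𝓡 3, 𝓡 3⟯ (bBase g).carrier)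
    (X : Type) [TopologicalSpace X] [T2Space X] [SecondCountableTopology X] [CompactSpace X]
    [ChartedSpace (EuclideanHalfSpace 4) X] [IsManifold (𝓡∂ 4) ∞ X]
    (G₀ : X₀ ≃ₘ⟮𝓡∂ 4, 𝓡∂ 4⟯ X)
    (h : Fin n → HandleAttachingMap 3 2 (Base g)) (D : MultiAttachmentData h (𝓡∂ 4) X)
    (d : Fin n → ℂ) (k : Fin n) (s : Bool),
    (∀ j, ‖d j‖ = 1) →
    (∀ j θ, (h j).attachingCircle θ ∈ page g (d j)) →
    (∀ j, j ≠ k → d j ≠ d k) →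
    (pageTwisting g (h k).attachingCircle (h k).attachingFraming = if s then -1 else 1) →
    (∀ (y : bX.carrier) (a : ↥(coresComplement h)), G₀ (bX.incl y) = D.jA a →
      ∃ c : ℝ, 0 < c ∧ w g ((bBase g).incl (Ψ y)).1 = (c : ℂ) * w g (a : Base g).1) →
    (∀ (y : bX.carrier) (j : Fin n) (b : ↥(beltPiece 3 2)), G₀ (bX.incl y) = D.jB j b →
      G₀ (bX.incl y) ∉ range D.jA →
      ∃ c : ℝ, 0 < c ∧ w g ((bBase g).incl (Ψ y)).1 = (c : ℂ) * d j) →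
    -- a FIBRED FAMILY OF ANNULUS CHARTS `φ (·,·,σ)` of the pages `d k · e^{iσ}`, `|σ| ≤ η₁`, around `γ_k`
    -- (the consumer's own: e.g. the `R`-transports of ONE chart of the belt page, `R` its sector rotation)
    ∀ (η₁ : ℝ) (φ : ℝ × ℝ × ℝ → Base g), 0 < η₁ →
    ContMDiff 𝓘(ℝ, ℝ × ℝ × ℝ) (𝓡∂ 4) ∞ φ →
    (∀ u r σ, φ (u + 1, r, σ) = φ (u, r, σ)) →
    (∀ u, φ (u, 0, 0) = (h k).attachingCircle (circlePt u)) →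
    (∀ u r σ, σ ∈ Set.Icc (-η₁) η₁ →
      φ (u, r, σ) ∈ page g (d k * Complex.exp ((σ : ℂ) * Complex.I))) →
    (∀ u r σ, r ∈ Set.Ioo (-1 : ℝ) 1 → σ ∈ Set.Icc (-η₁) η₁ → φ (u, r, σ) ∈ range (h k).toFun) →
    (∀ σ ∈ Set.Icc (-η₁) η₁,
      Set.InjOn (fun p : ℝ × ℝ => φ (p.1, p.2, σ)) (Set.Ico (0 : ℝ) 1 ×ˢ Set.Ioo (-1 : ℝ) 1)) →
    (∀ u r σ, r ∈ Set.Ioo (-1 : ℝ) 1 → σ ∈ Set.Icc (-η₁) η₁ →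
      0 < inner ℝ (deriv (fun r' => (φ (u, r', σ)).1) r)
        (cplxJ (deriv (fun u' => (φ (u', r, σ)).1) u))) →
    ∃ (η : ℝ) (G : ℝ × ℝ → ℝ × ℝ) (Λ : ℝ × ℝ × ℝ → bX.carrier),
      0 < η ∧ η ≤ η₁ ∧
      -- the return map `G` (lift of an annulus map; displacement `n₀ = ±1` between the two sides)
      ContDiff ℝ ∞ G ∧ (∀ u r, G (u + 1, r) = G (u, r) + (1, 0)) ∧
      (∀ u r, r ≤ -(1 / 2 : ℝ) → G (u, r) = (u, r)) ∧
      (∀ u r, (1 / 2 : ℝ) ≤ r → G (u, r) = (u + (if s then 1 else -1), r)) ∧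
      (∀ u r, r ∈ Set.Ioo (-1 : ℝ) 1 → (G (u, r)).2 ∈ Set.Ioo (-1 : ℝ) 1) ∧
      -- the two-sided fibred belt chart `Λ`
      ContMDiffOn 𝓘(ℝ, ℝ × ℝ × ℝ) (𝓡 3) ∞ Λ
        (Set.univ ×ˢ (Set.Ioo (-1 : ℝ) 1 ×ˢ Set.Ioo (-η) η)) ∧
      (∀ p ∈ Set.univ ×ˢ (Set.Ioo (-1 : ℝ) 1 ×ˢ Set.Ioo (-η) η),
        Function.Injective (mfderiv 𝓘(ℝ, ℝ × ℝ × ℝ) (𝓡 3) Λ p)) ∧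
      Set.InjOn Λ (Set.Ico (0 : ℝ) 1 ×ˢ (Set.Ioo (-1 : ℝ) 1 ×ˢ Set.Ioo (-η) η)) ∧
      (∀ u r σ, Λ (u + 1, r, σ) = Λ (u, r, σ)) ∧
      -- FIBRED
      (∀ u r σ, r ∈ Set.Ioo (-1 : ℝ) 1 → σ ∈ Set.Ioo (-η) η → ∃ c : ℝ, 0 < c ∧
        w g ((bBase g).incl (Ψ (Λ (u, r, σ)))).1 =
          (c : ℂ) * (d k * Complex.exp ((σ : ℂ) * Complex.I))) ∧
      -- BELOW and on the SIDES: plain seam, same chart coordinates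
      (∀ u r σ, r ∈ Set.Ioo (-1 : ℝ) 1 → σ ∈ Set.Ioo (-η) η → (σ ≤ -(η / 2) ∨ 1 / 2 ≤ |r|) →
        ∃ a : ↥(coresComplement h), (a : Base g) = φ (u, r, σ) ∧
          G₀ (bX.incl (Λ (u, r, σ))) = D.jA a) ∧
      -- ABOVE: plain seam, chart coordinates TWISTED by `G` (right-handed iff `s`)
      (∀ u r σ, r ∈ Set.Ioo (-1 : ℝ) 1 → η / 2 ≤ σ → σ < η →
        ∃ a : ↥(coresComplement h),
          (a : Base g) = φ ((G (u, r)).1, (G (u, r)).2, σ) ∧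
          G₀ (bX.incl (Λ (u, r, σ))) = D.jA a) ∧
      -- IMAGE: seam points over the chart, or (level `0`) deep belt points of handle `k`
      (∀ u r σ, r ∈ Set.Ioo (-1 : ℝ) 1 → σ ∈ Set.Ioo (-η) η →
        (∃ u' r', r' ∈ Set.Ioo (-1 : ℝ) 1 ∧ ∃ a : ↥(coresComplement h),
            (a : Base g) = φ (u', r', σ) ∧ G₀ (bX.incl (Λ (u, r, σ))) = D.jA a) ∨
        (σ = 0 ∧ (∀ a : ↥(coresComplement h), G₀ (bX.incl (Λ (u, r, σ))) ≠ D.jA a) ∧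
          ∃ b : ↥(beltPiece 3 2), G₀ (bX.incl (Λ (u, r, σ))) = D.jB k b)) ∧
      -- COVER: the dichotomy over the arc of angles `(θ_k − η, θ_k + η)`
      (∀ (y : bX.carrier) (σ : ℝ), σ ∈ Set.Ioo (-η) η →
        (∃ c : ℝ, 0 < c ∧ w g ((bBase g).incl (Ψ y)).1 =
          (c : ℂ) * (d k * Complex.exp ((σ : ℂ) * Complex.I))) →
        (∃ u r, r ∈ Set.Ioo (-1 : ℝ) 1 ∧ Λ (u, r, σ) = y) ∨
        (∃ a : ↥(coresComplement h), G₀ (bX.incl y) = D.jA a ∧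
          (a : Base g) ∉ (fun p : ℝ × ℝ => φ (p.1, p.2, σ)) ''
            (Set.univ ×ˢ Set.Icc (-(1 / 2) : ℝ) (1 / 2)))) := by
  sorry

/-- **PIECE (e×) — THE BRIDGE from the belt chart to shadows** (NODE; the open half of piece (e),
"class bookkeeping via N1a"): H4's two-sided fibred belt chart (piece (d)) implies the SHADOW-LEVEL
ACROSS-BELT MONODROMY `HD` consumed by the contract: for a loop `L` in the flat seam page `c₀` and its rigid
seam transport `L'` through `Ψ` by a signed angle `T` (`0 < |T| < 2π`) across EXACTLY ONE belt direction
`d k₁` (strictly inside the arc, no other direction on the closed arc),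
`shadow L' = transvection (stdSymp ℤ g) (v k₁, if 0 < T then s k₁ else ¬ s k₁) (shadow L)`.
PLAN: (1) charts: one N1a chart `φ₀` of the belt page around `γ_{k₁}` (G7 `exists_chart_of_isSmoothEmbedding`,
rescaled into the tube) transported by the rigid `R`: `φ (u,r,σ) := R_σ (φ₀ (u,r))` — the input of (d);
(2) split `T` at `±η/2` around the belt angle: the two outer parts are FREE (`shadow_seamTransport_free_ray`,
the extended-page form LANDED as p171136 — intermediate loops read back from `Ψ` lie on the right `w`-ray
but need not be flat; loops read on the base by `HurwitzMoveClasses.continuousOn_invFun_range`);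
(3) across `[−η/2, η/2]`: by COVER every transported point is in the slice of `Λ` or a plain seam point off
the inner half annulus; following the `Λ`-lines (FIBRED) from BELOW to ABOVE is a homotopy of loops read on
the base which ends in `τ_G ∘ (rigidly rotated L)`, `τ_G` the page map "chart coordinates composed with
`G`"; the rigid seam transport and the `Λ`-line transport are homotopic (both are sections of `θ_X` over
the arc: straight-line homotopy in the chart box, constant off it); (4) `τ_G` is homotopic on loops to N1a's
shear `τ_β` (straight-line homotopy of the lifts `G ≃ (u + β r · n₀, r)`, H4's `(e)-NOTE`), and
`shadow (τ_β ∘ ·) = transvection (v k₁, s k₁)` by N1a `shadow_pageDehnTwist_eq_transvection` (p157857),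
packaged as `HurwitzMoveClasses.shadow_eq_transvection_of_homotopic_twist` (LANDED); `v k₁` by `hshadow`,
the sign by the direction of `T` (clockwise = the inverse twist = `¬ s k₁`).  SIZE (honest): L, 700–1100
lines ((1) 150, (2) 150, (3) 350–600, (4) 100).  AUDIT POINT (F5) lives in (d)'s sign of `G`.
[cite: FarbMargalit2012, Prop. 6.3] -/
theorem piece_e_cross :
    (∀ (g n : ℕ) (X₀ : Type) [TopologicalSpace X₀] [T2Space X₀] [SecondCountableTopology X₀]
    [CompactSpace X₀] [ChartedSpace (EuclideanHalfSpace 4) X₀] [IsManifold (𝓡∂ 4) ∞ X₀]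
    (bX : BoundaryData (𝓡∂ 4) X₀ (𝓡 3)) (Ψ : bX.carrier ≃ₘ⟮𝓡 3, 𝓡 3⟯ (bBase g).carrier)
    (X : Type) [TopologicalSpace X] [T2Space X] [SecondCountableTopology X] [CompactSpace X]
    [ChartedSpace (EuclideanHalfSpace 4) X] [IsManifold (𝓡∂ 4) ∞ X]
    (G₀ : X₀ ≃ₘ⟮𝓡∂ 4, 𝓡∂ 4⟯ X)
    (h : Fin n → HandleAttachingMap 3 2 (Base g)) (D : MultiAttachmentData h (𝓡∂ 4) X)
    (d : Fin n → ℂ) (k : Fin n) (s : Bool),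
    (∀ j, ‖d j‖ = 1) →
    (∀ j θ, (h j).attachingCircle θ ∈ page g (d j)) →
    (∀ j, j ≠ k → d j ≠ d k) →
    (pageTwisting g (h k).attachingCircle (h k).attachingFraming = if s then -1 else 1) →
    (∀ (y : bX.carrier) (a : ↥(coresComplement h)), G₀ (bX.incl y) = D.jA a →
      ∃ c : ℝ, 0 < c ∧ w g ((bBase g).incl (Ψ y)).1 = (c : ℂ) * w g (a : Base g).1) →
    (∀ (y : bX.carrier) (j : Fin n) (b : ↥(beltPiece 3 2)), G₀ (bX.incl y) = D.jB j b →
      G₀ (bX.incl y) ∉ range D.jA →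
      ∃ c : ℝ, 0 < c ∧ w g ((bBase g).incl (Ψ y)).1 = (c : ℂ) * d j) →
    -- a FIBRED FAMILY OF ANNULUS CHARTS `φ (·,·,σ)` of the pages `d k · e^{iσ}`, `|σ| ≤ η₁`, around `γ_k`
    -- (the consumer's own: e.g. the `R`-transports of ONE chart of the belt page, `R` its sector rotation)
    ∀ (η₁ : ℝ) (φ : ℝ × ℝ × ℝ → Base g), 0 < η₁ →
    ContMDiff 𝓘(ℝ, ℝ × ℝ × ℝ) (𝓡∂ 4) ∞ φ →
    (∀ u r σ, φ (u + 1, r, σ) = φ (u, r, σ)) →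
    (∀ u, φ (u, 0, 0) = (h k).attachingCircle (circlePt u)) →
    (∀ u r σ, σ ∈ Set.Icc (-η₁) η₁ →
      φ (u, r, σ) ∈ page g (d k * Complex.exp ((σ : ℂ) * Complex.I))) →
    (∀ u r σ, r ∈ Set.Ioo (-1 : ℝ) 1 → σ ∈ Set.Icc (-η₁) η₁ → φ (u, r, σ) ∈ range (h k).toFun) →
    (∀ σ ∈ Set.Icc (-η₁) η₁,
      Set.InjOn (fun p : ℝ × ℝ => φ (p.1, p.2, σ)) (Set.Ico (0 : ℝ) 1 ×ˢ Set.Ioo (-1 : ℝ) 1)) →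
    (∀ u r σ, r ∈ Set.Ioo (-1 : ℝ) 1 → σ ∈ Set.Icc (-η₁) η₁ →
      0 < inner ℝ (deriv (fun r' => (φ (u, r', σ)).1) r)
        (cplxJ (deriv (fun u' => (φ (u', r, σ)).1) u))) →
    ∃ (η : ℝ) (G : ℝ × ℝ → ℝ × ℝ) (Λ : ℝ × ℝ × ℝ → bX.carrier),
      0 < η ∧ η ≤ η₁ ∧
      -- the return map `G` (lift of an annulus map; displacement `n₀ = ±1` between the two sides)
      ContDiff ℝ ∞ G ∧ (∀ u r, G (u + 1, r) = G (u, r) + (1, 0)) ∧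
      (∀ u r, r ≤ -(1 / 2 : ℝ) → G (u, r) = (u, r)) ∧
      (∀ u r, (1 / 2 : ℝ) ≤ r → G (u, r) = (u + (if s then 1 else -1), r)) ∧
      (∀ u r, r ∈ Set.Ioo (-1 : ℝ) 1 → (G (u, r)).2 ∈ Set.Ioo (-1 : ℝ) 1) ∧
      -- the two-sided fibred belt chart `Λ`
      ContMDiffOn 𝓘(ℝ, ℝ × ℝ × ℝ) (𝓡 3) ∞ Λ
        (Set.univ ×ˢ (Set.Ioo (-1 : ℝ) 1 ×ˢ Set.Ioo (-η) η)) ∧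
      (∀ p ∈ Set.univ ×ˢ (Set.Ioo (-1 : ℝ) 1 ×ˢ Set.Ioo (-η) η),
        Function.Injective (mfderiv 𝓘(ℝ, ℝ × ℝ × ℝ) (𝓡 3) Λ p)) ∧
      Set.InjOn Λ (Set.Ico (0 : ℝ) 1 ×ˢ (Set.Ioo (-1 : ℝ) 1 ×ˢ Set.Ioo (-η) η)) ∧
      (∀ u r σ, Λ (u + 1, r, σ) = Λ (u, r, σ)) ∧
      -- FIBRED
      (∀ u r σ, r ∈ Set.Ioo (-1 : ℝ) 1 → σ ∈ Set.Ioo (-η) η → ∃ c : ℝ, 0 < c ∧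
        w g ((bBase g).incl (Ψ (Λ (u, r, σ)))).1 =
          (c : ℂ) * (d k * Complex.exp ((σ : ℂ) * Complex.I))) ∧
      -- BELOW and on the SIDES: plain seam, same chart coordinates
      (∀ u r σ, r ∈ Set.Ioo (-1 : ℝ) 1 → σ ∈ Set.Ioo (-η) η → (σ ≤ -(η / 2) ∨ 1 / 2 ≤ |r|) →
        ∃ a : ↥(coresComplement h), (a : Base g) = φ (u, r, σ) ∧
          G₀ (bX.incl (Λ (u, r, σ))) = D.jA a) ∧
      -- ABOVE: plain seam, chart coordinates TWISTED by `G` (right-handed iff `s`)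
      (∀ u r σ, r ∈ Set.Ioo (-1 : ℝ) 1 → η / 2 ≤ σ → σ < η →
        ∃ a : ↥(coresComplement h),
          (a : Base g) = φ ((G (u, r)).1, (G (u, r)).2, σ) ∧
          G₀ (bX.incl (Λ (u, r, σ))) = D.jA a) ∧
      -- IMAGE: seam points over the chart, or (level `0`) deep belt points of handle `k`
      (∀ u r σ, r ∈ Set.Ioo (-1 : ℝ) 1 → σ ∈ Set.Ioo (-η) η →
        (∃ u' r', r' ∈ Set.Ioo (-1 : ℝ) 1 ∧ ∃ a : ↥(coresComplement h),
            (a : Base g) = φ (u', r', σ) ∧ G₀ (bX.incl (Λ (u, r, σ))) = D.jA a) ∨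
        (σ = 0 ∧ (∀ a : ↥(coresComplement h), G₀ (bX.incl (Λ (u, r, σ))) ≠ D.jA a) ∧
          ∃ b : ↥(beltPiece 3 2), G₀ (bX.incl (Λ (u, r, σ))) = D.jB k b)) ∧
      -- COVER: the dichotomy over the arc of angles `(θ_k − η, θ_k + η)`
      (∀ (y : bX.carrier) (σ : ℝ), σ ∈ Set.Ioo (-η) η →
        (∃ c : ℝ, 0 < c ∧ w g ((bBase g).incl (Ψ y)).1 =
          (c : ℂ) * (d k * Complex.exp ((σ : ℂ) * Complex.I))) →
        (∃ u r, r ∈ Set.Ioo (-1 : ℝ) 1 ∧ Λ (u, r, σ) = y) ∨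
        (∃ a : ↥(coresComplement h), G₀ (bX.incl y) = D.jA a ∧
          (a : Base g) ∉ (fun p : ℝ × ℝ => φ (p.1, p.2, σ)) ''
            (Set.univ ×ˢ Set.Icc (-(1 / 2) : ℝ) (1 / 2))))) →
    (∀ (g n : ℕ) (X₀ : Type) [TopologicalSpace X₀] [T2Space X₀] [SecondCountableTopology X₀] [CompactSpace X₀] [ChartedSpace (EuclideanHalfSpace 4) X₀] [IsManifold (𝓡∂ 4) ∞ X₀] (bX : BoundaryData (𝓡∂ 4) X₀ (𝓡 3)) (Ψ : bX.carrier ≃ₘ⟮𝓡 3, 𝓡 3⟯ (bBase g).carrier) (X : Type) [TopologicalSpace X] [T2Space X] [SecondCountableTopology X] [CompactSpace X] [ChartedSpace (EuclideanHalfSpace 4) X] [IsManifold (𝓡∂ 4) ∞ X] (G₀ : X₀ ≃ₘ⟮𝓡∂ 4, 𝓡∂ 4⟯ X) (h : Fin n → HandleAttachingMap 3 2 (Base g)) (D : MultiAttachmentData h (𝓡∂ 4) X) (d : Fin n → ℂ) (v : Fin n → (Fin g ⊕ Fin g → ℤ)) (s : Fin n → Bool), (∀ k, ‖d k‖ = 1)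 → (∀ k θ, (h k).attachingCircle θ ∈ page g (d k)) → (∀ k, shadow g (h k).attachingCircle (h k).continuous_attachingCircle = v k) → (∀ k, pageTwisting g (h k).attachingCircle (h k).attachingFraming = if s k then -1 else 1) → (∀ (y : bX.carrier) (a : ↥(coresComplement h)), G₀ (bX.incl y) = D.jA a → ∃ c : ℝ, 0 < c ∧ w g ((bBase g).incl (Ψ y)).1 = (c : ℂ) * w g (a : Base g).1) → (∀ (y : bX.carrier) (k : Fin n) (b : ↥(beltPiece 3 2)), G₀ (bX.incl y) = D.jB k b → G₀ (bX.incl y) ∉ range D.jA → ∃ c : ℝ, 0 < c ∧ w g ((bBase g).incl (Ψ y)).1 = (c : ℂ) * d k) → ∀ (k₁ : Fin n) (R : AmbientIsotopy (𝓡∂ 4) (Base g)), (∀ (t : ℝ) (x : Base g), rho g (R.toFun t x).1 = rho g x.1) → (∀ (t : ℝ) (x : Base g), w g (R.toFun t x).1 = Complex.exp ((t : ℂ) * Complex.I) * w g x.1) → (∀ (t : ℝ) (x : Base g), ‖cx (R.toFun t x).1‖ ^ 2 < 4 ↔ ‖cx x.1‖ ^ 2 < 4) → (∀ (t t' : ℝ)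 (x : Base g), R.toFun t (R.toFun t' x) = R.toFun (t + t') x) → ∀ (c₀ : ℂ) (T : ℝ), ‖c₀‖ = 1 → T ≠ 0 → |T| < 2 * π → (∃ t ∈ Set.Ioo (0 : ℝ) 1, d k₁ = c₀ * Complex.exp (((t * T : ℝ) : ℂ) * Complex.I)) → (∀ k, k ≠ k₁ → ∀ t ∈ Set.Icc (0 : ℝ) 1, d k ≠ c₀ * Complex.exp (((t * T : ℝ) : ℂ) * Complex.I)) → ∀ (L L' : Metric.sphere (0 : EuclideanSpace ℝ (Fin 2)) 1 → Base g) (hL : Continuous L) (hL' : Continuous L') (y y' : Metric.sphere (0 : EuclideanSpace ℝ (Fin 2)) 1 → bX.carrier) (a a' : Metric.sphere (0 : EuclideanSpace ℝ (Fin 2)) 1 → ↥(coresComplement h)), (∀ θ, L θ ∈ page g c₀) → (∀ θ, G₀ (bX.incl (y θ)) = D.jA (a θ)) → (∀ θ, ((a θ : ↥(coresComplement h)) : Base g) = L θ) → (∀ θ, (bBase g).incl (Ψ (y' θ)) = R.toFun T ((bBase g).incl (Ψ (y θ)))) → (∀ θ, G₀ (bX.incl (y' θ)) = D.jA (a' θ))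 → (∀ θ, ((a' θ : ↥(coresComplement h)) : Base g) = L' θ) → shadow g L' hL' = transvection (stdSymp ℤ g) (v k₁, if 0 < T then s k₁ else !s k₁) (shadow g L hL)) := by
  sorry

/-- **(d) as consumed by the contract** (`HD`): the shadow-level across-belt monodromy, from H4's belt
chart (piece (d)) through the bridge (piece (e×)). [cite: GompfStipsicz1999, §8.2] -/
theorem piece_dsh : ∀ (g n : ℕ) (X₀ : Type) [TopologicalSpace X₀] [T2Space X₀] [SecondCountableTopology X₀] [CompactSpace X₀] [ChartedSpace (EuclideanHalfSpace 4) X₀] [IsManifold (𝓡∂ 4) ∞ X₀] (bX : BoundaryData (𝓡∂ 4) X₀ (𝓡 3)) (Ψ : bX.carrier ≃ₘ⟮𝓡 3, 𝓡 3⟯ (bBase g).carrier) (X : Type) [TopologicalSpace X] [T2Space X] [SecondCountableTopology X] [CompactSpace X] [ChartedSpace (EuclideanHalfSpace 4) X] [IsManifold (𝓡∂ 4) ∞ X] (G₀ : X₀ ≃ₘ⟮𝓡∂ 4, 𝓡∂ 4⟯ X) (h : Fin n → HandleAttachingMap 3 2 (Base g)) (D : MultiAttachmentData h (𝓡∂ 4)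 X) (d : Fin n → ℂ) (v : Fin n → (Fin g ⊕ Fin g → ℤ)) (s : Fin n → Bool), (∀ k, ‖d k‖ = 1) → (∀ k θ, (h k).attachingCircle θ ∈ page g (d k)) → (∀ k, shadow g (h k).attachingCircle (h k).continuous_attachingCircle = v k) → (∀ k, pageTwisting g (h k).attachingCircle (h k).attachingFraming = if s k then -1 else 1) → (∀ (y : bX.carrier) (a : ↥(coresComplement h)), G₀ (bX.incl y) = D.jA a → ∃ c : ℝ, 0 < c ∧ w g ((bBase g).incl (Ψ y)).1 = (c : ℂ) * w g (a : Base g).1) → (∀ (y : bX.carrier) (k : Fin n) (b : ↥(beltPiece 3 2)), G₀ (bX.incl y) = D.jB k b → G₀ (bX.incl y) ∉ range D.jA → ∃ c : ℝ, 0 < c ∧ w g ((bBase g).incl (Ψ y)).1 = (c : ℂ) * d k) → ∀ (k₁ : Fin n) (R : AmbientIsotopy (𝓡∂ 4) (Base g)), (∀ (t : ℝ) (x : Base g), rho g (R.toFun t x).1 = rho g x.1) → (∀ (t : ℝ) (x : Base g), w g (R.toFun t x).1 = Complex.exp ((t : ℂ) * Complex.I) * w g x.1) → (∀ (t : ℝ)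 (x : Base g), ‖cx (R.toFun t x).1‖ ^ 2 < 4 ↔ ‖cx x.1‖ ^ 2 < 4) → (∀ (t t' : ℝ) (x : Base g), R.toFun t (R.toFun t' x) = R.toFun (t + t') x) → ∀ (c₀ : ℂ) (T : ℝ), ‖c₀‖ = 1 → T ≠ 0 → |T| < 2 * π → (∃ t ∈ Set.Ioo (0 : ℝ) 1, d k₁ = c₀ * Complex.exp (((t * T : ℝ) : ℂ) * Complex.I)) → (∀ k, k ≠ k₁ → ∀ t ∈ Set.Icc (0 : ℝ) 1, d k ≠ c₀ * Complex.exp (((t * T : ℝ) : ℂ) * Complex.I)) → ∀ (L L' : Metric.sphere (0 : EuclideanSpace ℝ (Fin 2)) 1 → Base g) (hL : Continuous L) (hL' : Continuous L') (y y' : Metric.sphere (0 : EuclideanSpace ℝ (Fin 2)) 1 → bX.carrier) (a a' : Metric.sphere (0 : EuclideanSpace ℝ (Fin 2)) 1 → ↥(coresComplement h)), (∀ θ, L θ ∈ page g c₀) → (∀ θ, G₀ (bX.incl (y θ)) = D.jA (a θ)) → (∀ θ, ((a θ : ↥(coresComplement h)) : Base g) = L θ) → (∀ θ, (bBase g).incl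 (Ψ (y' θ)) = R.toFun T ((bBase g).incl (Ψ (y θ)))) → (∀ θ, G₀ (bX.incl (y' θ)) = D.jA (a' θ)) → (∀ θ, ((a' θ : ↥(coresComplement h)) : Base g) = L' θ) → shadow g L' hL' = transvection (stdSymp ℤ g) (v k₁, if 0 < T then s k₁ else !s k₁) (shadow g L hL) :=
  piece_e_cross piece_d

/-! ## §E  PIECE (e) — free seam transport preserves shadows (LANDED p170593) -/

/-- **PIECE (e) — free seam transport preserves the shadow** (LANDED: `helper_shadow_seamTransport_free`,
`…HurwitzMoveClasses.lean`, p170593 ACCEPTED, imported here): hypothesis `HE` of the contract.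
[cite: GompfStipsicz1999, §8.2] -/
theorem piece_e_free : ∀ (g n : ℕ) (X₀ : Type) [TopologicalSpace X₀] [ChartedSpace (EuclideanHalfSpace 4) X₀] (bX : BoundaryData (𝓡∂ 4) X₀ (𝓡 3)) (Ψ : bX.carrier ≃ₘ⟮𝓡 3, 𝓡 3⟯ (bBase g).carrier) (X : Type) [TopologicalSpace X] [ChartedSpace (EuclideanHalfSpace 4) X] (G₀ : X₀ ≃ₘ⟮𝓡∂ 4, 𝓡∂ 4⟯ X) (h : Fin n → HandleAttachingMap 3 2 (Base g)) (D : MultiAttachmentData h (𝓡∂ 4) X) (d : Fin n → ℂ), (∀ k, ‖d k‖ = 1) → (∀ (y : bX.carrier) (a : ↥(coresComplement h)), G₀ (bX.incl y) = D.jA a → ∃ c : ℝ, 0 < c ∧ w g ((bBase g).incl (Ψ y)).1 = (c : ℂ) * w g (a : Base g).1) → (∀ (y : bX.carrier) (k : Fin n) (b : ↥(beltPiece 3 2)), G₀ (bX.incl y) = D.jB k b → G₀ (bX.incl y) ∉ Set.range D.jA → ∃ c : ℝ, 0 < c ∧ w g ((bBase g).incl (Ψ y)).1 = (c : ℂ)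 * d k) → ∀ (R : AmbientIsotopy (𝓡∂ 4) (Base g)), (∀ (t : ℝ) (x : Base g), rho g (R.toFun t x).1 = rho g x.1) → (∀ (t : ℝ) (x : Base g), w g (R.toFun t x).1 = Complex.exp ((t : ℂ) * Complex.I) * w g x.1) → ∀ (c₀ : ℂ) (T : ℝ), ‖c₀‖ = 1 → (∀ (k : Fin n), ∀ t ∈ Set.Icc (0 : ℝ) 1, d k ≠ c₀ * Complex.exp (((t * T : ℝ) : ℂ) * Complex.I)) → ∀ (L L' : Metric.sphere (0 : EuclideanSpace ℝ (Fin 2)) 1 → Base g) (hL : Continuous L) (hL' : Continuous L') (y y' : Metric.sphere (0 : EuclideanSpace ℝ (Fin 2)) 1 → bX.carrier) (a a' : Metric.sphere (0 : EuclideanSpace ℝ (Fin 2)) 1 → ↥(coresComplement h)), (∀ θ, L θ ∈ page g c₀) → (∀ θ, G₀ (bX.incl (y θ)) = D.jA (a θ)) → (∀ θ, ((a θ : ↥(coresComplement h)) : Base g) = L θ) → (∀ θ, (bBase g).incl (Ψ (y' θ)) = R.toFun T ((bBase g).incl (Ψ (y θ)))) → (∀ θ, G₀ (bX.incl (y' θ))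 = D.jA (a' θ)) → (∀ θ, ((a' θ : ↥(coresComplement h)) : Base g) = L' θ) → shadow g L' hL' = shadow g L hL :=
  helper_shadow_seamTransport_free

/-! ## §F  THE CONTRACT (LANDED as `…HurwitzMoveDichotomy.lean` p170781 + `…HurwitzMoveContract.lean` p171574,
both ACCEPTED; verbatim copies, the modules being built on the farm at the time of writing) -/

namespace ContractPrep

/-! ### prep §1 The rigid page rotation of the base -/

/-- **The rigid page rotation of `Base g`**: an ambient isotopy `R` preserving `rho` and the flat
part, with the flow law, turning the page coordinate of EVERY point rigidly: `w (R_t x) = e^{it} w x`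
(`helper_rotFlow_page` with the constant profile `1`; the linear ODE `(w ∘ R_· x)' = i · w` integrated
through `e^{-it} w (R_t x) = const`). [cite: Baykur2006, proof of Thm. 5.1, pp. 13–14] -/
theorem exists_rigidRotation (g : ℕ) : ∃ R : AmbientIsotopy (𝓡∂ 4) (Base g),
    (∀ (t : ℝ) (x : Base g), rho g (R.toFun t x).1 = rho g x.1) ∧
    (∀ (t : ℝ) (x : Base g), w g (R.toFun t x).1 = Complex.exp ((t : ℂ) * Complex.I) * w g x.1) ∧
    (∀ (t : ℝ) (x : Base g), ‖cx (R.toFun t x).1‖ ^ 2 < 4 ↔ ‖cx x.1‖ ^ 2 < 4) ∧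
    (∀ (t t' : ℝ) (x : Base g), R.toFun t (R.toFun t' x) = R.toFun (t + t') x) := by
  obtain ⟨R, θ, -, h0, hadd, hR, hρ, hflat, hder, -, -⟩ :=
    helper_rotFlow_page g (fun _ => (1 : ℝ)) contDiff_const
  refine ⟨R, fun t x => by rw [hR, hρ], fun t x => ?_, fun t x => by rw [hR]; exact hflat t x.1,
    fun t t' x => Subtype.ext (by rw [hR, hR, hR, hadd])⟩
  have hx : rho g x.1 ≤ 3 / 10 := by
    have := x.2; simp only [mem_preimage, mem_Iic] at this; exact this.trans (by norm_num)
  -- `e^{-is} w (θ (s, x))` is constant in `s`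
  have hd : ∀ s : ℝ, HasDerivAt (fun s : ℝ => Complex.exp (-((s : ℂ) * Complex.I)) * w g (θ (s, x.1))) 0 s := by
    intro s
    have h1 : HasDerivAt (fun u : ℝ => -((u : ℂ) * Complex.I)) (-Complex.I) s := by
      have h := ((hasDerivAt_ofReal' s).mul_const Complex.I).neg
      rwa [one_mul] at h
    have he := (Complex.hasDerivAt_exp (-((s : ℂ) * Complex.I))).comp s h1
    refine (he.mul (hder x.1 hx s)).congr_deriv ?_
    simp only [Function.comp_def]
    push_cast
    ring
  have hc := is_const_of_deriv_eq_zero (fun s => (hd s).differentiableAt) (fun s => (hd s).deriv) t 0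
  simp only [Complex.ofReal_zero, zero_mul, neg_zero, Complex.exp_zero, one_mul, h0] at hc
  rw [hR]
  calc w g (θ (t, x.1)) = Complex.exp ((t : ℂ) * Complex.I) *
        (Complex.exp (-((t : ℂ) * Complex.I)) * w g (θ (t, x.1))) := by
          rw [← mul_assoc, ← Complex.exp_add, add_neg_cancel, Complex.exp_zero, one_mul]
    _ = Complex.exp ((t : ℂ) * Complex.I) * w g x.1 := by rw [hc]

/-! ### prep §2 Transfer of the seam and belt clauses along a dichotomy -/

section Transfer

variable {g n : ℕ} {X₀ : Type} [TopologicalSpace X₀] [ChartedSpace (EuclideanHalfSpace 4) X₀]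
  (bX : BoundaryData (𝓡∂ 4) X₀ (𝓡 3)) (Ψ : bX.carrier → (bBase g).carrier)
  {X : Type} [TopologicalSpace X] [ChartedSpace (EuclideanHalfSpace 4) X]
  (G₀ : X₀ ≃ₘ⟮𝓡∂ 4, 𝓡∂ 4⟯ X)
  {h : Fin n → HandleAttachingMap 3 2 (Base g)} (D : MultiAttachmentData h (𝓡∂ 4) X) (d : Fin n → ℂ)
  {X' : Type} [TopologicalSpace X'] [ChartedSpace (EuclideanHalfSpace 4) X']
  {h' : Fin n → HandleAttachingMap 3 2 (Base g)} (D' : MultiAttachmentData h' (𝓡∂ 4) X')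
  (d' : Fin n → ℂ) (G : X ≃ₘ⟮𝓡∂ 4, 𝓡∂ 4⟯ X')

/-- **The seam and belt clauses of a re-presentation from its dichotomy.**  Old datum `(h, D)` of `X`
with directions `d` and the seam and belt clauses through `G₀`; new datum `(h', D')` of `X'` with
directions `d'` and `G : X ≅ X'`; DICHOTOMY: every new seam point `D'.jA a'` with `G⁻¹ (D'.jA a') ∈ ∂X`
is an old seam point of the same page direction or an old deep belt point of handle `k` with
`w a' ∈ ℝ_{>0} d k`, and every new deep belt point of handle `k'` with boundary `G`-preimage is an old
seam point `D.jA a` with `w a ∈ ℝ_{>0} d' k'` or an old deep belt point of a handle `k` with `d k = d' k'`.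
Then the seam and belt clauses hold for the new datum through `G₀ ≫ G`. [folklore] -/
theorem clauses_of_dichotomy
    (hseam : ∀ (y : bX.carrier) (a : ↥(coresComplement h)), G₀ (bX.incl y) = D.jA a →
      ∃ c : ℝ, 0 < c ∧ w g ((bBase g).incl (Ψ y)).1 = (c : ℂ) * w g (a : Base g).1)
    (hbelt : ∀ (y : bX.carrier) (k : Fin n) (b : ↥(beltPiece 3 2)), G₀ (bX.incl y) = D.jB k b →
      G₀ (bX.incl y) ∉ range D.jA →
      ∃ c : ℝ, 0 < c ∧ w g ((bBase g).incl (Ψ y)).1 = (c : ℂ) * d k)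
    (hO1 : ∀ a' : ↥(coresComplement h'), G.symm (D'.jA a') ∈ (𝓡∂ 4).boundary X →
      (∃ a : ↥(coresComplement h), G.symm (D'.jA a') = D.jA a ∧
        ∃ c : ℝ, 0 < c ∧ w g (a' : Base g).1 = (c : ℂ) * w g (a : Base g).1) ∨
      (∃ (k : Fin n) (b : ↥(beltPiece 3 2)), G.symm (D'.jA a') = D.jB k b ∧
        G.symm (D'.jA a') ∉ range D.jA ∧ ∃ c : ℝ, 0 < c ∧ w g (a' : Base g).1 = (c : ℂ) * d k))
    (hO2 : ∀ (k' : Fin n) (b' : ↥(beltPiece 3 2)), D'.jB k' b' ∉ range D'.jA →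
      G.symm (D'.jB k' b') ∈ (𝓡∂ 4).boundary X →
      (∃ a : ↥(coresComplement h), G.symm (D'.jB k' b') = D.jA a ∧
        ∃ c : ℝ, 0 < c ∧ w g (a : Base g).1 = (c : ℂ) * d' k') ∨
      (∃ (k : Fin n) (b : ↥(beltPiece 3 2)), G.symm (D'.jB k' b') = D.jB k b ∧
        G.symm (D'.jB k' b') ∉ range D.jA ∧ d k = d' k')) :
    (∀ (y : bX.carrier) (a' : ↥(coresComplement h')), (G₀.trans G) (bX.incl y) = D'.jA a' →
      ∃ c : ℝ, 0 < c ∧ w g ((bBase g).incl (Ψ y)).1 = (c : ℂ) * w g (a' : Base g).1) ∧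
    (∀ (y : bX.carrier) (k : Fin n) (b : ↥(beltPiece 3 2)), (G₀.trans G) (bX.incl y) = D'.jB k b →
      (G₀.trans G) (bX.incl y) ∉ range D'.jA →
      ∃ c : ℝ, 0 < c ∧ w g ((bBase g).incl (Ψ y)).1 = (c : ℂ) * d' k) := by
  constructor
  · intro y a' hy
    rw [Diffeomorph.coe_trans, comp_apply] at hy
    have hGs : G.symm (D'.jA a') = G₀ (bX.incl y) := by rw [← hy, Diffeomorph.symm_apply_apply]
    have hb : G.symm (D'.jA a') ∈ (𝓡∂ 4).boundary X := hGs ▸ G₀_incl_mem_boundary bX G₀ y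
    rcases hO1 a' hb with ⟨a, hGa, c, hc, hw⟩ | ⟨k, b, hGb, hnot, c, hc, hw⟩
    · obtain ⟨c₂, hc₂, hw₂⟩ := hseam y a (hGs ▸ hGa)
      refine ⟨c₂ / c, div_pos hc₂ hc, ?_⟩
      have hc' : (c : ℂ) ≠ 0 := by exact_mod_cast hc.ne'
      rw [hw₂, hw]; push_cast; field_simp
    · obtain ⟨c₂, hc₂, hw₂⟩ := hbelt y k b (hGs ▸ hGb) (hGs ▸ hnot)
      refine ⟨c₂ / c, div_pos hc₂ hc, ?_⟩
      have hc' : (c : ℂ) ≠ 0 := by exact_mod_cast hc.ne'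
      rw [hw₂, hw]; push_cast; field_simp
  · intro y k' b' hy hdeep
    rw [Diffeomorph.coe_trans, comp_apply] at hy hdeep
    have hGs : G.symm (D'.jB k' b') = G₀ (bX.incl y) := by rw [← hy, Diffeomorph.symm_apply_apply]
    have hb : G.symm (D'.jB k' b') ∈ (𝓡∂ 4).boundary X := hGs ▸ G₀_incl_mem_boundary bX G₀ y
    rcases hO2 k' b' (hy ▸ hdeep) hb with ⟨a, hGa, c, hc, hw⟩ | ⟨k, b, hGb, hnot, hdk⟩
    · obtain ⟨c₂, hc₂, hw₂⟩ := hseam y a (hGs ▸ hGa)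
      exact ⟨c₂ * c, mul_pos hc₂ hc, by rw [hw₂, hw]; push_cast; ring⟩
    · obtain ⟨c₂, hc₂, hw₂⟩ := hbelt y k b (hGs ▸ hGb) (hGs ▸ hnot)
      exact ⟨c₂, hc₂, by rw [hw₂, hdk]⟩

end Transfer

/-! ### prep §3 Angle bookkeeping -/

/-- **The sub-arc after the push-off**: for `0 < ε/φ < 1` and `t ∈ [0, 1]` the direction
`d₀ e^{iε} e^{it(φ − ε)}` is `d₀ e^{it'' φ}` with `t'' ∈ [ε/φ, 1] ⊆ [0, 1]`, and it is not `d₀` when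
`|φ| < 2π`. [folklore] -/
theorem subarc {d₀ : ℂ} {φ ε t : ℝ} (hφ0 : φ ≠ 0) (hφ : |φ| < 2 * π) (hε0 : 0 < ε / φ) (hε1 : ε / φ < 1)
    (ht : t ∈ Icc (0 : ℝ) 1) :
    (∃ t'' ∈ Icc (0 : ℝ) 1, d₀ * Complex.exp ((ε : ℂ) * Complex.I) *
        Complex.exp ((((t * (φ - ε)) : ℝ) : ℂ) * Complex.I) =
      d₀ * Complex.exp ((((t'' * φ) : ℝ) : ℂ) * Complex.I)) ∧
    (‖d₀‖ = 1 → d₀ * Complex.exp ((ε : ℂ) * Complex.I) *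
        Complex.exp ((((t * (φ - ε)) : ℝ) : ℂ) * Complex.I) ≠ d₀) := by
  have e1 : d₀ * Complex.exp ((ε : ℂ) * Complex.I) * Complex.exp ((((t * (φ - ε)) : ℝ) : ℂ) * Complex.I) =
      d₀ * Complex.exp ((((ε + t * (φ - ε)) : ℝ) : ℂ) * Complex.I) := by
    rw [mul_assoc, ← Complex.exp_add]; push_cast; ring_nf
  have hq : ε / φ + t * (1 - ε / φ) ∈ Icc (0 : ℝ) 1 := by
    constructor <;> nlinarith [ht.1, ht.2]
  have e2 : ε + t * (φ - ε) = (ε / φ + t * (1 - ε / φ)) * φ := by field_simp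
  refine ⟨⟨ε / φ + t * (1 - ε / φ), hq, by rw [e1, e2]⟩, fun hd hh => ?_⟩
  rw [e1] at hh
  have hd0 : d₀ ≠ 0 := by rintro rfl; simp at hd
  have h1 : Complex.exp ((((ε + t * (φ - ε)) : ℝ) : ℂ) * Complex.I) = 1 := by
    have := mul_left_cancel₀ hd0 (hh.trans (mul_one d₀).symm); exact this
  refine exp_ofReal_mul_I_ne_one ?_ ?_ h1
  · rw [e2]; exact mul_ne_zero (by nlinarith [ht.1, ht.2]) hφ0
  · -- `|ε + t (φ − ε)| ≤ |φ|`
    rw [e2, abs_mul]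
    calc |ε / φ + t * (1 - ε / φ)| * |φ| ≤ 1 * |φ| := by
          refine mul_le_mul_of_nonneg_right ?_ (abs_nonneg _)
          rw [abs_le]; constructor <;> nlinarith [hq.1, hq.2]
      _ < 2 * π := by rw [one_mul]; exact hφ

end ContractPrep

open ContractPrep

/-! ### the registered form of the rigid rotation (landed as `helper_exists_rigidRotation`, p170781) -/

/-- **Sub-goal `helper_exists_rigidRotation`** (fully qualified): the rigid page rotation of the base,
see `exists_rigidRotation`. [cite: Baykur2006, proof of Thm. 5.1, pp. 13–14] -/
theorem rigidRotation_registered : ∀ (g : ℕ), ∃ R : Literature.Topology.FourManifolds.AmbientIsotopy (𝓡∂ 4) (Literature.Topology.FourManifolds.LefschetzBase.Base g), (∀ (t : ℝ) (x : Literature.Topology.FourManifolds.LefschetzBase.Base g), Literature.Topology.FourManifolds.LefschetzBase.rho g (R.toFun t x).1 = Literature.Topology.FourManifolds.LefschetzBase.rho g x.1) ∧ (∀ (t : ℝ) (x : Literature.Topology.FourManifolds.LefschetzBase.Base g), Literature.Topology.FourManifolds.LefschetzBase.w g (R.toFun t x).1 = Complex.exp ((t : ℂ) * Complex.I) * Literature.Topology.FourManifolds.LefschetzBase.w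 g x.1) ∧ (∀ (t : ℝ) (x : Literature.Topology.FourManifolds.LefschetzBase.Base g), ‖Literature.Topology.FourManifolds.LefschetzBase.cx (R.toFun t x).1‖ ^ 2 < 4 ↔ ‖Literature.Topology.FourManifolds.LefschetzBase.cx x.1‖ ^ 2 < 4) ∧ (∀ (t t' : ℝ) (x : Literature.Topology.FourManifolds.LefschetzBase.Base g), R.toFun t (R.toFun t' x) = R.toFun (t + t') x) :=
  exists_rigidRotation


/-! ### assembly §1 The sign of the remaining angle after the push-off -/

/-- (registered as `helper_sameSign_of_pushoff` in the tree file): if `0 < ε/φ < 1` then `φ − ε` is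
non-zero, has the sign of `φ`, and `|φ − ε| < |φ|`. [folklore] -/
theorem sameSign_of_pushoff : ∀ (φ ε : ℝ), 0 < ε / φ → ε / φ < 1 → (0 < φ - ε ↔ 0 < φ) ∧ φ - ε ≠ 0 ∧ |φ - ε| < |φ| := by
  intro φ ε h0 h1
  have hφ : φ ≠ 0 := by rintro rfl; simp at h0
  rcases lt_or_gt_of_ne hφ with hneg | hpos
  · have hε : φ < ε := by rwa [div_lt_one_of_neg hneg] at h1
    have hε0 : ε < 0 := by
      rcases lt_trichotomy ε 0 with hl | rfl | hg
      · exact hl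
      · simp at h0
      · exact absurd h0 (not_lt.2 (div_nonpos_of_nonneg_of_nonpos hg.le hneg.le))
    refine ⟨⟨fun h => absurd h (by linarith), fun h => absurd h (by linarith)⟩, by linarith, ?_⟩
    rw [abs_of_neg (by linarith), abs_of_neg hneg]; linarith
  · have hε : ε < φ := by rwa [div_lt_one hpos] at h1
    have hε0 : 0 < ε := (div_pos_iff_of_pos_right hpos).1 h0
    refine ⟨⟨fun _ => hpos, fun _ => by linarith⟩, by linarith, ?_⟩
    rw [abs_of_pos (by linarith), abs_of_pos hpos]; linarith

/-! ### assembly §2 `node_N1_move_of_pieces` -/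

set_option maxHeartbeats 800000 in
-- four ∀-texts of 40–60 binders each as hypotheses; the two `obtain`s destructure 27 components
/-- **`node_N1_move` from the pieces (c₁), (c₂), (d), (e)** — see the module docstring.  The conclusion
is the text of `node_N1_move` (= hypothesis `hmove` of `swap_of_move`) VERBATIM, so that with the tree
`stub_M2geo := m2geo_of_transfer (transfer_of_swap' (swap_of_move (node_N1_move_of_pieces HC1 HC2 HD HE)))`.
[cite: GompfStipsicz1999, §8.2] -/
theorem node_N1_move_of_pieces
    (HC1 : ∀ (g n : ℕ) (X₀ : Type) [TopologicalSpace X₀] [T2Space X₀] [SecondCountableTopology X₀] [CompactSpace X₀] [ChartedSpace (EuclideanHalfSpace 4) X₀] [IsManifold (𝓡∂ 4) ∞ X₀] (bX : BoundaryData (𝓡∂ 4) X₀ (𝓡 3)) (Ψ : bX.carrier ≃ₘ⟮𝓡 3, 𝓡 3⟯ (bBase g).carrier) (X : Type) [TopologicalSpace X] [T2Space X] [SecondCountableTopology X] [CompactSpace X] [ChartedSpace (EuclideanHalfSpace 4) X] [IsManifold (𝓡∂ 4) ∞ X] (G₀ : X₀ ≃ₘ⟮𝓡∂ 4, 𝓡∂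 4⟯ X) (h : Fin n → HandleAttachingMap 3 2 (Base g)) (D : MultiAttachmentData h (𝓡∂ 4) X) (d : Fin n → ℂ), (∀ k, ‖d k‖ = 1) → (∀ k θ, (h k).attachingCircle θ ∈ page g (d k)) → (∀ (y : bX.carrier) (a : ↥(coresComplement h)), G₀ (bX.incl y) = D.jA a → ∃ c : ℝ, 0 < c ∧ w g ((bBase g).incl (Ψ y)).1 = (c : ℂ) * w g (a : Base g).1) → (∀ (y : bX.carrier) (k : Fin n) (b : ↥(beltPiece 3 2)), G₀ (bX.incl y) = D.jB k b → G₀ (bX.incl y) ∉ range D.jA → ∃ c : ℝ, 0 < c ∧ w g ((bBase g).incl (Ψ y)).1 = (c : ℂ) * d k) → ∀ (k₀ : Fin n) (ψ : ℝ) (R : AmbientIsotopy (𝓡∂ 4) (Base g)), ψ ≠ 0 → |ψ| < 2 * π → (∀ (t : ℝ) (x : Base g), rho g (R.toFun t x).1 = rho g x.1) → (∀ (t : ℝ) (x : Base g), w g (R.toFun t x).1 = Complex.exp ((t : ℂ) * Complex.I) * w g x.1) → (∀ (t : ℝ) (x : Base g), ‖cx (R.toFun t x).1‖ ^ 2 <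 4 ↔ ‖cx x.1‖ ^ 2 < 4) → (∀ (t t' : ℝ) (x : Base g), R.toFun t (R.toFun t' x) = R.toFun (t + t') x) → (∀ k, k ≠ k₀ → ∀ t ∈ Set.Icc (0 : ℝ) 1, d k ≠ d k₀ * Complex.exp (((t * ψ : ℝ) : ℂ) * Complex.I)) → ∃ (X' : Type) (_ : TopologicalSpace X') (_ : T2Space X') (_ : SecondCountableTopology X') (_ : CompactSpace X') (_ : ChartedSpace (EuclideanHalfSpace 4) X') (_ : IsManifold (𝓡∂ 4) ∞ X') (h' : Fin n → HandleAttachingMap 3 2 (Base g)) (D' : MultiAttachmentData h' (𝓡∂ 4) X') (G : X ≃ₘ⟮𝓡∂ 4, 𝓡∂ 4⟯ X') (R₁ R₃ : AmbientIsotopy (𝓡∂ 4) (Base g)) (τ₁ τ₃ ε : ℝ) (L L' : Metric.sphere (0 : EuclideanSpace ℝ (Fin 2)) 1 → Base g) (y y' : Metric.sphere (0 : EuclideanSpace ℝ (Fin 2)) 1 → bX.carrier) (a a' : Metric.sphere (0 : EuclideanSpace ℝ (Fin 2)) 1 → ↥(coresComplement h)), (0 < ε / ψ ∧ ε / ψ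 < 1) ∧ Continuous L ∧ Continuous L' ∧ (∀ θ, L θ = R₁.toFun τ₁ ((h k₀).attachingCircle θ)) ∧ (∀ θ, L θ ∈ page g (d k₀ * Complex.exp ((ε : ℂ) * Complex.I))) ∧ (∀ θ, G₀ (bX.incl (y θ)) = D.jA (a θ)) ∧ (∀ θ, ((a θ : ↥(coresComplement h)) : Base g) = L θ) ∧ (∀ θ, (bBase g).incl (Ψ (y' θ)) = R.toFun (ψ - ε) ((bBase g).incl (Ψ (y θ)))) ∧ (∀ θ, G₀ (bX.incl (y' θ)) = D.jA (a' θ)) ∧ (∀ θ, ((a' θ : ↥(coresComplement h)) : Base g) = L' θ) ∧ (∀ θ, (h' k₀).attachingCircle θ = R₃.toFun τ₃ (L' θ)) ∧ (∀ θ, (h' k₀).attachingCircle θ ∈ page g (d k₀ * Complex.exp ((ψ : ℂ) * Complex.I))) ∧ (∀ k, k ≠ k₀ → (h' k).attachingCircle = (h k).attachingCircle ∧ (h' k).attachingFraming = (h k).attachingFraming) ∧ pageTwisting g (h' k₀).attachingCircle (h' k₀).attachingFraming = pageTwisting g (h k₀).attachingCircle (h k₀).attachingFraming ∧ (∀ a'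 : ↥(coresComplement h'), G.symm (D'.jA a') ∈ (𝓡∂ 4).boundary X → (∃ a : ↥(coresComplement h), G.symm (D'.jA a') = D.jA a ∧ ∃ c : ℝ, 0 < c ∧ w g (a' : Base g).1 = (c : ℂ) * w g (a : Base g).1) ∨ (∃ (k : Fin n) (b : ↥(beltPiece 3 2)), G.symm (D'.jA a') = D.jB k b ∧ G.symm (D'.jA a') ∉ range D.jA ∧ ∃ c : ℝ, 0 < c ∧ w g (a' : Base g).1 = (c : ℂ) * d k)) ∧ (∀ (k' : Fin n) (b' : ↥(beltPiece 3 2)), D'.jB k' b' ∉ range D'.jA → G.symm (D'.jB k' b') ∈ (𝓡∂ 4).boundary X → (∃ a : ↥(coresComplement h), G.symm (D'.jB k' b') = D.jA a ∧ ∃ c : ℝ, 0 < c ∧ w g (a : Base g).1 = (c : ℂ) * Function.update d k₀ (d k₀ * Complex.exp ((ψ : ℂ) * Complex.I)) k') ∨ (∃ (k : Fin n) (b : ↥(beltPiece 3 2)), G.symm (D'.jB k' b') = D.jB k b ∧ G.symm (D'.jB k' b') ∉ range D.jA ∧ d k = Function.update d k₀ (d k₀ * Complex.exp ((ψ : ℂ)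 * Complex.I)) k')))
    (HC2 : ∀ (g n : ℕ) (X₀ : Type) [TopologicalSpace X₀] [T2Space X₀] [SecondCountableTopology X₀] [CompactSpace X₀] [ChartedSpace (EuclideanHalfSpace 4) X₀] [IsManifold (𝓡∂ 4) ∞ X₀] (bX : BoundaryData (𝓡∂ 4) X₀ (𝓡 3)) (Ψ : bX.carrier ≃ₘ⟮𝓡 3, 𝓡 3⟯ (bBase g).carrier) (X : Type) [TopologicalSpace X] [T2Space X] [SecondCountableTopology X] [CompactSpace X] [ChartedSpace (EuclideanHalfSpace 4) X] [IsManifold (𝓡∂ 4) ∞ X] (G₀ : X₀ ≃ₘ⟮𝓡∂ 4, 𝓡∂ 4⟯ X) (h : Fin n → HandleAttachingMap 3 2 (Base g)) (D : MultiAttachmentData h (𝓡∂ 4) X) (d : Fin n → ℂ), (∀ k, ‖d k‖ = 1) → (∀ k θ, (h k).attachingCircle θ ∈ page g (d k)) → (∀ (y : bX.carrier) (a : ↥(coresComplement h)), G₀ (bX.incl y) = D.jA a → ∃ c : ℝ, 0 < c ∧ w g ((bBase g).incl (Ψ y)).1 = (c : ℂ) * w g (a : Base g).1) → (∀ (y :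 bX.carrier) (k : Fin n) (b : ↥(beltPiece 3 2)), G₀ (bX.incl y) = D.jB k b → G₀ (bX.incl y) ∉ range D.jA → ∃ c : ℝ, 0 < c ∧ w g ((bBase g).incl (Ψ y)).1 = (c : ℂ) * d k) → ∀ (k₀ k₁ : Fin n) (ψ : ℝ) (R : AmbientIsotopy (𝓡∂ 4) (Base g)), k₁ ≠ k₀ → ψ ≠ 0 → |ψ| < 2 * π → (∀ (t : ℝ) (x : Base g), rho g (R.toFun t x).1 = rho g x.1) → (∀ (t : ℝ) (x : Base g), w g (R.toFun t x).1 = Complex.exp ((t : ℂ) * Complex.I) * w g x.1) → (∀ (t : ℝ) (x : Base g), ‖cx (R.toFun t x).1‖ ^ 2 < 4 ↔ ‖cx x.1‖ ^ 2 < 4) → (∀ (t t' : ℝ) (x : Base g), R.toFun t (R.toFun t' x) = R.toFun (t + t') x) → (∃ t ∈ Set.Ioo (0 : ℝ) 1, d k₁ = d k₀ * Complex.exp (((t * ψ : ℝ) : ℂ) * Complex.I)) → (∀ k, k ≠ k₀ → k ≠ k₁ → ∀ t ∈ Set.Icc (0 : ℝ) 1, d k ≠ d k₀ * Complex.exp (((t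 * ψ : ℝ) : ℂ) * Complex.I)) → ∃ (X' : Type) (_ : TopologicalSpace X') (_ : T2Space X') (_ : SecondCountableTopology X') (_ : CompactSpace X') (_ : ChartedSpace (EuclideanHalfSpace 4) X') (_ : IsManifold (𝓡∂ 4) ∞ X') (h' : Fin n → HandleAttachingMap 3 2 (Base g)) (D' : MultiAttachmentData h' (𝓡∂ 4) X') (G : X ≃ₘ⟮𝓡∂ 4, 𝓡∂ 4⟯ X') (R₁ R₃ : AmbientIsotopy (𝓡∂ 4) (Base g)) (τ₁ τ₃ ε : ℝ) (L L' : Metric.sphere (0 : EuclideanSpace ℝ (Fin 2)) 1 → Base g) (y y' : Metric.sphere (0 : EuclideanSpace ℝ (Fin 2)) 1 → bX.carrier) (a a' : Metric.sphere (0 : EuclideanSpace ℝ (Fin 2)) 1 → ↥(coresComplement h)), (0 < ε / ψ ∧ ε / ψ < 1) ∧ (∃ t ∈ Set.Ioo (0 : ℝ) 1, d k₁ = d k₀ * Complex.exp ((ε : ℂ) * Complex.I) * Complex.exp (((t * (ψ - ε) : ℝ) : ℂ) * Complex.I)) ∧ Continuous L ∧ Continuous L' ∧ (∀ θ, L θ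 = R₁.toFun τ₁ ((h k₀).attachingCircle θ)) ∧ (∀ θ, L θ ∈ page g (d k₀ * Complex.exp ((ε : ℂ) * Complex.I))) ∧ (∀ θ, G₀ (bX.incl (y θ)) = D.jA (a θ)) ∧ (∀ θ, ((a θ : ↥(coresComplement h)) : Base g) = L θ) ∧ (∀ θ, (bBase g).incl (Ψ (y' θ)) = R.toFun (ψ - ε) ((bBase g).incl (Ψ (y θ)))) ∧ (∀ θ, G₀ (bX.incl (y' θ)) = D.jA (a' θ)) ∧ (∀ θ, ((a' θ : ↥(coresComplement h)) : Base g) = L' θ) ∧ (∀ θ, (h' k₀).attachingCircle θ = R₃.toFun τ₃ (L' θ)) ∧ (∀ θ, (h' k₀).attachingCircle θ ∈ page g (d k₀ * Complex.exp ((ψ : ℂ) * Complex.I))) ∧ (∀ k, k ≠ k₀ → (h' k).attachingCircle = (h k).attachingCircle ∧ (h' k).attachingFraming = (h k).attachingFraming) ∧ pageTwisting g (h' k₀).attachingCircle (h' k₀).attachingFraming = pageTwisting g (h k₀).attachingCircle (h k₀).attachingFraming ∧ (∀ a' : ↥(coresComplement h'), G.symm (D'.jA a') ∈ (𝓡∂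 4).boundary X → (∃ a : ↥(coresComplement h), G.symm (D'.jA a') = D.jA a ∧ ∃ c : ℝ, 0 < c ∧ w g (a' : Base g).1 = (c : ℂ) * w g (a : Base g).1) ∨ (∃ (k : Fin n) (b : ↥(beltPiece 3 2)), G.symm (D'.jA a') = D.jB k b ∧ G.symm (D'.jA a') ∉ range D.jA ∧ ∃ c : ℝ, 0 < c ∧ w g (a' : Base g).1 = (c : ℂ) * d k)) ∧ (∀ (k' : Fin n) (b' : ↥(beltPiece 3 2)), D'.jB k' b' ∉ range D'.jA → G.symm (D'.jB k' b') ∈ (𝓡∂ 4).boundary X → (∃ a : ↥(coresComplement h), G.symm (D'.jB k' b') = D.jA a ∧ ∃ c : ℝ, 0 < c ∧ w g (a : Base g).1 = (c : ℂ) * Function.update d k₀ (d k₀ * Complex.exp ((ψ : ℂ) * Complex.I)) k') ∨ (∃ (k : Fin n) (b : ↥(beltPiece 3 2)), G.symm (D'.jB k' b') = D.jB k b ∧ G.symm (D'.jB k' b') ∉ range D.jA ∧ d k = Function.update d k₀ (d k₀ * Complex.exp ((ψ : ℂ) * Complex.I)) k')))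
    (HD : ∀ (g n : ℕ) (X₀ : Type) [TopologicalSpace X₀] [T2Space X₀] [SecondCountableTopology X₀] [CompactSpace X₀] [ChartedSpace (EuclideanHalfSpace 4) X₀] [IsManifold (𝓡∂ 4) ∞ X₀] (bX : BoundaryData (𝓡∂ 4) X₀ (𝓡 3)) (Ψ : bX.carrier ≃ₘ⟮𝓡 3, 𝓡 3⟯ (bBase g).carrier) (X : Type) [TopologicalSpace X] [T2Space X] [SecondCountableTopology X] [CompactSpace X] [ChartedSpace (EuclideanHalfSpace 4) X] [IsManifold (𝓡∂ 4) ∞ X] (G₀ : X₀ ≃ₘ⟮𝓡∂ 4, 𝓡∂ 4⟯ X) (h : Fin n → HandleAttachingMap 3 2 (Base g)) (D : MultiAttachmentData h (𝓡∂ 4) X) (d : Fin n → ℂ) (v : Fin n → (Fin g ⊕ Fin g → ℤ)) (s : Fin n → Bool), (∀ k, ‖d k‖ = 1) → (∀ k θ, (h k).attachingCircle θ ∈ page g (d k)) → (∀ k, shadow g (h k).attachingCircle (h k).continuous_attachingCircle = v k) → (∀ k, pageTwisting g (h k).attachingCircle (h k).attachingFraming = if s k then -1 else 1) → (∀ (y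 : bX.carrier) (a : ↥(coresComplement h)), G₀ (bX.incl y) = D.jA a → ∃ c : ℝ, 0 < c ∧ w g ((bBase g).incl (Ψ y)).1 = (c : ℂ) * w g (a : Base g).1) → (∀ (y : bX.carrier) (k : Fin n) (b : ↥(beltPiece 3 2)), G₀ (bX.incl y) = D.jB k b → G₀ (bX.incl y) ∉ range D.jA → ∃ c : ℝ, 0 < c ∧ w g ((bBase g).incl (Ψ y)).1 = (c : ℂ) * d k) → ∀ (k₁ : Fin n) (R : AmbientIsotopy (𝓡∂ 4) (Base g)), (∀ (t : ℝ) (x : Base g), rho g (R.toFun t x).1 = rho g x.1) → (∀ (t : ℝ) (x : Base g), w g (R.toFun t x).1 = Complex.exp ((t : ℂ) * Complex.I) * w g x.1) → (∀ (t : ℝ) (x : Base g), ‖cx (R.toFun t x).1‖ ^ 2 < 4 ↔ ‖cx x.1‖ ^ 2 < 4) → (∀ (t t' : ℝ) (x : Base g), R.toFun t (R.toFun t' x) = R.toFun (t + t') x) → ∀ (c₀ : ℂ) (T : ℝ), ‖c₀‖ = 1 → T ≠ 0 → |T| < 2 * π → (∃ t ∈ Set.Ioo (0 : ℝ) 1,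 d k₁ = c₀ * Complex.exp (((t * T : ℝ) : ℂ) * Complex.I)) → (∀ k, k ≠ k₁ → ∀ t ∈ Set.Icc (0 : ℝ) 1, d k ≠ c₀ * Complex.exp (((t * T : ℝ) : ℂ) * Complex.I)) → ∀ (L L' : Metric.sphere (0 : EuclideanSpace ℝ (Fin 2)) 1 → Base g) (hL : Continuous L) (hL' : Continuous L') (y y' : Metric.sphere (0 : EuclideanSpace ℝ (Fin 2)) 1 → bX.carrier) (a a' : Metric.sphere (0 : EuclideanSpace ℝ (Fin 2)) 1 → ↥(coresComplement h)), (∀ θ, L θ ∈ page g c₀) → (∀ θ, G₀ (bX.incl (y θ)) = D.jA (a θ)) → (∀ θ, ((a θ : ↥(coresComplement h)) : Base g) = L θ) → (∀ θ, (bBase g).incl (Ψ (y' θ)) = R.toFun T ((bBase g).incl (Ψ (y θ)))) → (∀ θ, G₀ (bX.incl (y' θ)) = D.jA (a' θ)) → (∀ θ, ((a' θ : ↥(coresComplement h)) : Base g) = L' θ) → shadow g L' hL' = transvection (stdSymp ℤ g) (v k₁, if 0 < T then s k₁ else !s k₁) (shadow g L hL))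
    (HE : ∀ (g n : ℕ) (X₀ : Type) [TopologicalSpace X₀] [ChartedSpace (EuclideanHalfSpace 4) X₀] (bX : BoundaryData (𝓡∂ 4) X₀ (𝓡 3)) (Ψ : bX.carrier ≃ₘ⟮𝓡 3, 𝓡 3⟯ (bBase g).carrier) (X : Type) [TopologicalSpace X] [ChartedSpace (EuclideanHalfSpace 4) X] (G₀ : X₀ ≃ₘ⟮𝓡∂ 4, 𝓡∂ 4⟯ X) (h : Fin n → HandleAttachingMap 3 2 (Base g)) (D : MultiAttachmentData h (𝓡∂ 4) X) (d : Fin n → ℂ), (∀ k, ‖d k‖ = 1) → (∀ (y : bX.carrier) (a : ↥(coresComplement h)), G₀ (bX.incl y) = D.jA a → ∃ c : ℝ, 0 < c ∧ w g ((bBase g).incl (Ψ y)).1 = (c : ℂ) * w g (a : Base g).1) → (∀ (y : bX.carrier) (k : Fin n) (b : ↥(beltPiece 3 2)), G₀ (bX.incl y) = D.jB k b → G₀ (bX.incl y) ∉ Set.range D.jA → ∃ c : ℝ, 0 < c ∧ w g ((bBase g).incl (Ψ y)).1 = (c : ℂ) * d k) → ∀ (R : AmbientIsotopy (𝓡∂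 4) (Base g)), (∀ (t : ℝ) (x : Base g), rho g (R.toFun t x).1 = rho g x.1) → (∀ (t : ℝ) (x : Base g), w g (R.toFun t x).1 = Complex.exp ((t : ℂ) * Complex.I) * w g x.1) → ∀ (c₀ : ℂ) (T : ℝ), ‖c₀‖ = 1 → (∀ (k : Fin n), ∀ t ∈ Set.Icc (0 : ℝ) 1, d k ≠ c₀ * Complex.exp (((t * T : ℝ) : ℂ) * Complex.I)) → ∀ (L L' : Metric.sphere (0 : EuclideanSpace ℝ (Fin 2)) 1 → Base g) (hL : Continuous L) (hL' : Continuous L') (y y' : Metric.sphere (0 : EuclideanSpace ℝ (Fin 2)) 1 → bX.carrier) (a a' : Metric.sphere (0 : EuclideanSpace ℝ (Fin 2)) 1 → ↥(coresComplement h)), (∀ θ, L θ ∈ page g c₀) → (∀ θ, G₀ (bX.incl (y θ)) = D.jA (a θ)) → (∀ θ, ((a θ : ↥(coresComplement h)) : Base g) = L θ) → (∀ θ, (bBase g).incl (Ψ (y' θ)) = R.toFun T ((bBase g).incl (Ψ (y θ)))) → (∀ θ, G₀ (bX.incl (y' θ)) = D.jA (a' θ)) → (∀ θ, ((a' θ :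 ↥(coresComplement h)) : Base g) = L' θ) → shadow g L' hL' = shadow g L hL) :
    ∀ (g n : ℕ) (X₀ : Type) [TopologicalSpace X₀] [T2Space X₀] [SecondCountableTopology X₀]
      [CompactSpace X₀] [ChartedSpace (EuclideanHalfSpace 4) X₀] [IsManifold (𝓡∂ 4) ∞ X₀]
      (bX : BoundaryData (𝓡∂ 4) X₀ (𝓡 3)) (Ψ : bX.carrier ≃ₘ⟮𝓡 3, 𝓡 3⟯ (bBase g).carrier)
      (X : Type) [TopologicalSpace X] [T2Space X] [SecondCountableTopology X] [CompactSpace X]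
      [ChartedSpace (EuclideanHalfSpace 4) X] [IsManifold (𝓡∂ 4) ∞ X]
      (G₀ : X₀ ≃ₘ⟮𝓡∂ 4, 𝓡∂ 4⟯ X)
      (h : Fin n → HandleAttachingMap 3 2 (Base g)) (D : MultiAttachmentData h (𝓡∂ 4) X)
      (d : Fin n → ℂ) (v : Fin n → (Fin g ⊕ Fin g → ℤ)) (s : Fin n → Bool),
      (∀ k, ‖d k‖ = 1) →
      (∀ k θ, (h k).attachingCircle θ ∈ page g (d k)) →
      (∀ k, shadow g (h k).attachingCircle (h k).continuous_attachingCircle = v k) →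
      (∀ k, pageTwisting g (h k).attachingCircle (h k).attachingFraming = if s k then -1 else 1) →
      (∀ (y : bX.carrier) (a : ↥(coresComplement h)), G₀ (bX.incl y) = D.jA a →
        ∃ c : ℝ, 0 < c ∧ w g ((bBase g).incl (Ψ y)).1 = (c : ℂ) * w g (a : Base g).1) →
      (∀ (y : bX.carrier) (k : Fin n) (b : ↥(beltPiece 3 2)), G₀ (bX.incl y) = D.jB k b →
        G₀ (bX.incl y) ∉ range D.jA →
        ∃ c : ℝ, 0 < c ∧ w g ((bBase g).incl (Ψ y)).1 = (c : ℂ) * d k) →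
      ∀ (k₀ : Fin n) (φ : ℝ) (cross : Option (Fin n)), φ ≠ 0 → |φ| < 2 * π →
      (∀ k, k ≠ k₀ → cross ≠ some k → ∀ t ∈ Set.Icc (0 : ℝ) 1,
        d k ≠ d k₀ * Complex.exp (((t * φ : ℝ) : ℂ) * Complex.I)) →
      (∀ k₁, cross = some k₁ → k₁ ≠ k₀ ∧
        (∃ t ∈ Set.Ioo (0 : ℝ) 1, d k₁ = d k₀ * Complex.exp (((t * φ : ℝ) : ℂ) * Complex.I))) →
      ∃ (X' : Type) (_ : TopologicalSpace X') (_ : T2Space X') (_ : SecondCountableTopology X')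
        (_ : CompactSpace X') (_ : ChartedSpace (EuclideanHalfSpace 4) X')
        (_ : IsManifold (𝓡∂ 4) ∞ X') (h' : Fin n → HandleAttachingMap 3 2 (Base g))
        (D' : MultiAttachmentData h' (𝓡∂ 4) X') (G : X ≃ₘ⟮𝓡∂ 4, 𝓡∂ 4⟯ X'),
        (∀ k θ, (h' k).attachingCircle θ ∈
          page g (Function.update d k₀ (d k₀ * Complex.exp ((φ : ℂ) * Complex.I)) k)) ∧
        (∀ k, shadow g (h' k).attachingCircle (h' k).continuous_attachingCircle =
          Function.update v k₀ (Option.elim cross (v k₀)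
            (fun k₁ => transvection (stdSymp ℤ g) (v k₁, if 0 < φ then s k₁ else !s k₁) (v k₀))) k) ∧
        (∀ k, pageTwisting g (h' k).attachingCircle (h' k).attachingFraming = (if s k then -1 else 1)) ∧
        (∀ (y : bX.carrier) (a' : ↥(coresComplement h')), (G₀.trans G) (bX.incl y) = D'.jA a' →
          ∃ c : ℝ, 0 < c ∧ w g ((bBase g).incl (Ψ y)).1 = (c : ℂ) * w g (a' : Base g).1) ∧
        (∀ (y : bX.carrier) (k : Fin n) (b : ↥(beltPiece 3 2)), (G₀.trans G) (bX.incl y) = D'.jB k b →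
          (G₀.trans G) (bX.incl y) ∉ range D'.jA →
          ∃ c : ℝ, 0 < c ∧ w g ((bBase g).incl (Ψ y)).1 =
            (c : ℂ) * Function.update d k₀ (d k₀ * Complex.exp ((φ : ℂ) * Complex.I)) k) := by
  intro g n X₀ _ _ _ _ _ _ bX Ψ X _ _ _ _ _ _ G₀ h D d v s hd hpg hsh htw hseam hbelt k₀ φ cross hφ0 hφ
    hfree hcross
  obtain ⟨R, hRρ, hRw, hRflat, hRflow⟩ := exists_rigidRotation g
  -- shadows of equal loops (with different continuity proofs) agree
  have shc : ∀ {K K' : Metric.sphere (0 : EuclideanSpace ℝ (Fin 2)) 1 → Base g} (hK : Continuous K)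
      (hK' : Continuous K'), K = K' → shadow g K hK = shadow g K' hK' := by
    rintro K K' hK hK' rfl; rfl
  have hεn : ∀ ε : ℝ, ‖d k₀ * Complex.exp ((ε : ℂ) * Complex.I)‖ = 1 := fun ε => by
    rw [norm_mul, hd, Complex.norm_exp_ofReal_mul_I, mul_one]
  cases cross with
  | none =>
    have hfree' : ∀ k, k ≠ k₀ → ∀ t ∈ Set.Icc (0 : ℝ) 1,
        d k ≠ d k₀ * Complex.exp (((t * φ : ℝ) : ℂ) * Complex.I) :=
      fun k hk t ht => hfree k hk (by simp) t ht
    obtain ⟨X', i1, i2, i3, i4, i5, i6, h', D', G, R₁, R₃, τ₁, τ₃, ε, L, L', y, y', a, a', ⟨hε0, hε1⟩, hLc,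
      hL'c, hL, hLp, hy, ha, hrel, hy', ha', hcirc, hpg', hothers, htw', hO1, hO2⟩ :=
      HC1 g n X₀ bX Ψ X G₀ h D d hd hpg hseam hbelt k₀ φ R hφ0 hφ hRρ hRw hRflat hRflow hfree'
    -- the sub-arc `[ε, φ]` is free of directions
    have harc : ∀ k, ∀ t ∈ Set.Icc (0 : ℝ) 1, d k ≠ d k₀ * Complex.exp ((ε : ℂ) * Complex.I) *
        Complex.exp (((t * (φ - ε) : ℝ) : ℂ) * Complex.I) := by
      intro k t ht
      obtain ⟨⟨t'', ht'', he⟩, hne⟩ := subarc (d₀ := d k₀) hφ0 hφ hε0 hε1 ht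
      by_cases hk : k = k₀
      · subst hk; exact fun hh => hne (hd _) hh.symm
      · rw [he]; exact hfree' k hk t'' ht''
    have hshL' : shadow g L' hL'c = shadow g L hLc :=
      HE g n X₀ bX Ψ X G₀ h D d hd hseam hbelt R hRρ hRw (d k₀ * Complex.exp ((ε : ℂ) * Complex.I)) (φ - ε)
        (hεn ε) harc L L' hLc hL'c y y' a a' hLp hy ha hrel hy' ha'
    have hnew : shadow g (h' k₀).attachingCircle (h' k₀).continuous_attachingCircle = v k₀ := by
      have e1 : (h' k₀).attachingCircle = R₃.toFun τ₃ ∘ L' := funext hcirc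
      have e2 : L = R₁.toFun τ₁ ∘ (h k₀).attachingCircle := funext hL
      have c1 : Continuous (R₃.toFun τ₃ ∘ L') := (R₃.toDiffeomorph τ₃).continuous.comp hL'c
      have c2 : Continuous (R₁.toFun τ₁ ∘ (h k₀).attachingCircle) :=
        (R₁.toDiffeomorph τ₁).continuous.comp (h k₀).continuous_attachingCircle
      rw [shc _ c1 e1, shadow_comp_ambientIsotopy R₃ τ₃ hL'c c1, hshL', shc hLc c2 e2,
        shadow_comp_ambientIsotopy R₁ τ₁ (h k₀).continuous_attachingCircle c2, hsh k₀]
    refine ⟨X', i1, i2, i3, i4, i5, i6, h', D', G, ?_, ?_, ?_,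
      (clauses_of_dichotomy bX Ψ G₀ D d D' _ G hseam hbelt hO1 hO2).1,
      (clauses_of_dichotomy bX Ψ G₀ D d D' _ G hseam hbelt hO1 hO2).2⟩
    · intro k θ
      by_cases hk : k = k₀
      · subst hk; rw [Function.update_self]; exact hpg' θ
      · rw [Function.update_of_ne hk, (hothers k hk).1]; exact hpg k θ
    · intro k
      by_cases hk : k = k₀
      · subst hk; rw [Function.update_self, Option.elim_none]; exact hnew
      · rw [Function.update_of_ne hk, shc _ (h k).continuous_attachingCircle (hothers k hk).1]
        exact hsh k
    · intro k
      by_cases hk : k = k₀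
      · subst hk; rw [htw']; exact htw _
      · rw [(hothers k hk).1, (hothers k hk).2]; exact htw k
  | some k₁ =>
    obtain ⟨hk₁, t₁, ht₁, hdk₁⟩ := hcross k₁ rfl
    have hfree' : ∀ k, k ≠ k₀ → k ≠ k₁ → ∀ t ∈ Set.Icc (0 : ℝ) 1,
        d k ≠ d k₀ * Complex.exp (((t * φ : ℝ) : ℂ) * Complex.I) :=
      fun k hk hk1 t ht => hfree k hk (fun hh => hk1 (Option.some_injective _ hh).symm) t ht
    obtain ⟨X', i1, i2, i3, i4, i5, i6, h', D', G, R₁, R₃, τ₁, τ₃, ε, L, L', y, y', a, a', ⟨hε0, hε1⟩,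
      ⟨t₂, ht₂, hdk₂⟩, hLc, hL'c, hL, hLp, hy, ha, hrel, hy', ha', hcirc, hpg', hothers, htw', hO1, hO2⟩ :=
      HC2 g n X₀ bX Ψ X G₀ h D d hd hpg hseam hbelt k₀ k₁ φ R hk₁ hφ0 hφ hRρ hRw hRflat hRflow
        ⟨t₁, ht₁, hdk₁⟩ hfree'
    obtain ⟨hsign, hT0, hTabs⟩ := sameSign_of_pushoff φ ε hε0 hε1
    have hT : |φ - ε| < 2 * π := hTabs.trans hφ
    -- the sub-arc `[ε, φ]` contains `d k₁` strictly and no other direction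
    have harc : ∀ k, k ≠ k₁ → ∀ t ∈ Set.Icc (0 : ℝ) 1, d k ≠ d k₀ * Complex.exp ((ε : ℂ) * Complex.I) *
        Complex.exp (((t * (φ - ε) : ℝ) : ℂ) * Complex.I) := by
      intro k hk1 t ht
      obtain ⟨⟨t'', ht'', he⟩, hne⟩ := subarc (d₀ := d k₀) hφ0 hφ hε0 hε1 ht
      by_cases hk : k = k₀
      · subst hk; exact fun hh => hne (hd _) hh.symm
      · rw [he]; exact hfree' k hk hk1 t'' ht''
    have hshL' : shadow g L' hL'c =
        transvection (stdSymp ℤ g) (v k₁, if 0 < φ - ε then s k₁ else !s k₁) (shadow g L hLc) :=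
      HD g n X₀ bX Ψ X G₀ h D d v s hd hpg hsh htw hseam hbelt k₁ R hRρ hRw hRflat hRflow
        (d k₀ * Complex.exp ((ε : ℂ) * Complex.I)) (φ - ε) (hεn ε) hT0 hT ⟨t₂, ht₂, hdk₂⟩ harc
        L L' hLc hL'c y y' a a' hLp hy ha hrel hy' ha'
    have hif : (if 0 < φ - ε then s k₁ else !s k₁) = (if 0 < φ then s k₁ else !s k₁) := by
      by_cases hp : 0 < φ
      · rw [if_pos hp, if_pos (hsign.2 hp)]
      · rw [if_neg hp, if_neg (fun hh => hp (hsign.1 hh))]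
    have hnew : shadow g (h' k₀).attachingCircle (h' k₀).continuous_attachingCircle =
        transvection (stdSymp ℤ g) (v k₁, if 0 < φ then s k₁ else !s k₁) (v k₀) := by
      have e1 : (h' k₀).attachingCircle = R₃.toFun τ₃ ∘ L' := funext hcirc
      have e2 : L = R₁.toFun τ₁ ∘ (h k₀).attachingCircle := funext hL
      have c1 : Continuous (R₃.toFun τ₃ ∘ L') := (R₃.toDiffeomorph τ₃).continuous.comp hL'c
      have c2 : Continuous (R₁.toFun τ₁ ∘ (h k₀).attachingCircle) :=
        (R₁.toDiffeomorph τ₁).continuous.comp (h k₀).continuous_attachingCircle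
      rw [shc _ c1 e1, shadow_comp_ambientIsotopy R₃ τ₃ hL'c c1, hshL', hif, shc hLc c2 e2,
        shadow_comp_ambientIsotopy R₁ τ₁ (h k₀).continuous_attachingCircle c2, hsh k₀]
    refine ⟨X', i1, i2, i3, i4, i5, i6, h', D', G, ?_, ?_, ?_,
      (clauses_of_dichotomy bX Ψ G₀ D d D' _ G hseam hbelt hO1 hO2).1,
      (clauses_of_dichotomy bX Ψ G₀ D d D' _ G hseam hbelt hO1 hO2).2⟩
    · intro k θ
      by_cases hk : k = k₀
      · subst hk; rw [Function.update_self]; exact hpg' θ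
      · rw [Function.update_of_ne hk, (hothers k hk).1]; exact hpg k θ
    · intro k
      by_cases hk : k = k₀
      · subst hk; rw [Function.update_self, Option.elim_some]; exact hnew
      · rw [Function.update_of_ne hk, shc _ (h k).continuous_attachingCircle (hothers k hk).1]
        exact hsh k
    · intro k
      by_cases hk : k = k₀
      · subst hk; rw [htw']; exact htw _
      · rw [(hothers k hk).1, (hothers k hk).2]; exact htw k


/-! ## §G  `node_N1_move` VERBATIM, sorry-free from the pieces; the registered top `stub_M2geo` -/

/-- **N1-move — G4's node VERBATIM (`N1_HurwitzMove_Design.lean` §2 = hypothesis `hmove` of the landed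
`swap_of_move`), ASSEMBLED SORRY-FREE from the pieces**:
`node_N1_move_of_pieces piece_c1 piece_c2 piece_dsh piece_e_free` — the sorries live in `piece_c1`,
`piece_c2` (the slice constructions), `piece_d` (H4's belt chart) and `piece_e_cross` (the bridge) only.
[cite: GompfStipsicz1999, §8.2] -/
theorem node_N1_move :
    ∀ (g n : ℕ) (X₀ : Type) [TopologicalSpace X₀] [T2Space X₀] [SecondCountableTopology X₀]
      [CompactSpace X₀] [ChartedSpace (EuclideanHalfSpace 4) X₀] [IsManifold (𝓡∂ 4) ∞ X₀]
      (bX : BoundaryData (𝓡∂ 4) X₀ (𝓡 3)) (Ψ : bX.carrier ≃ₘ⟮𝓡 3, 𝓡 3⟯ (bBase g).carrier)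
      (X : Type) [TopologicalSpace X] [T2Space X] [SecondCountableTopology X] [CompactSpace X]
      [ChartedSpace (EuclideanHalfSpace 4) X] [IsManifold (𝓡∂ 4) ∞ X]
      (G₀ : X₀ ≃ₘ⟮𝓡∂ 4, 𝓡∂ 4⟯ X)
      (h : Fin n → HandleAttachingMap 3 2 (Base g)) (D : MultiAttachmentData h (𝓡∂ 4) X)
      (d : Fin n → ℂ) (v : Fin n → (Fin g ⊕ Fin g → ℤ)) (s : Fin n → Bool),
      (∀ k, ‖d k‖ = 1) →
      (∀ k θ, (h k).attachingCircle θ ∈ page g (d k)) →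
      (∀ k, shadow g (h k).attachingCircle (h k).continuous_attachingCircle = v k) →
      (∀ k, pageTwisting g (h k).attachingCircle (h k).attachingFraming = if s k then -1 else 1) →
      (∀ (y : bX.carrier) (a : ↥(coresComplement h)), G₀ (bX.incl y) = D.jA a →
        ∃ c : ℝ, 0 < c ∧ w g ((bBase g).incl (Ψ y)).1 = (c : ℂ) * w g (a : Base g).1) →
      (∀ (y : bX.carrier) (k : Fin n) (b : ↥(beltPiece 3 2)), G₀ (bX.incl y) = D.jB k b →
        G₀ (bX.incl y) ∉ range D.jA →
        ∃ c : ℝ, 0 < c ∧ w g ((bBase g).incl (Ψ y)).1 = (c : ℂ) * d k) →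
      ∀ (k₀ : Fin n) (φ : ℝ) (cross : Option (Fin n)), φ ≠ 0 → |φ| < 2 * π →
      (∀ k, k ≠ k₀ → cross ≠ some k → ∀ t ∈ Set.Icc (0 : ℝ) 1,
        d k ≠ d k₀ * Complex.exp (((t * φ : ℝ) : ℂ) * Complex.I)) →
      (∀ k₁, cross = some k₁ → k₁ ≠ k₀ ∧
        (∃ t ∈ Set.Ioo (0 : ℝ) 1, d k₁ = d k₀ * Complex.exp (((t * φ : ℝ) : ℂ) * Complex.I))) →
      ∃ (X' : Type) (_ : TopologicalSpace X') (_ : T2Space X') (_ : SecondCountableTopology X')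
        (_ : CompactSpace X') (_ : ChartedSpace (EuclideanHalfSpace 4) X')
        (_ : IsManifold (𝓡∂ 4) ∞ X') (h' : Fin n → HandleAttachingMap 3 2 (Base g))
        (D' : MultiAttachmentData h' (𝓡∂ 4) X') (G : X ≃ₘ⟮𝓡∂ 4, 𝓡∂ 4⟯ X'),
        (∀ k θ, (h' k).attachingCircle θ ∈
          page g (Function.update d k₀ (d k₀ * Complex.exp ((φ : ℂ) * Complex.I)) k)) ∧
        (∀ k, shadow g (h' k).attachingCircle (h' k).continuous_attachingCircle =
          Function.update v k₀ (Option.elim cross (v k₀)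
            (fun k₁ => transvection (stdSymp ℤ g) (v k₁, if 0 < φ then s k₁ else !s k₁) (v k₀))) k) ∧
        (∀ k, pageTwisting g (h' k).attachingCircle (h' k).attachingFraming = (if s k then -1 else 1)) ∧
        (∀ (y : bX.carrier) (a' : ↥(coresComplement h')), (G₀.trans G) (bX.incl y) = D'.jA a' →
          ∃ c : ℝ, 0 < c ∧ w g ((bBase g).incl (Ψ y)).1 = (c : ℂ) * w g (a' : Base g).1) ∧
        (∀ (y : bX.carrier) (k : Fin n) (b : ↥(beltPiece 3 2)), (G₀.trans G) (bX.incl y) = D'.jB k b →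
          (G₀.trans G) (bX.incl y) ∉ range D'.jA →
          ∃ c : ℝ, 0 < c ∧ w g ((bBase g).incl (Ψ y)).1 =
            (c : ℂ) * Function.update d k₀ (d k₀ * Complex.exp ((φ : ℂ) * Complex.I)) k) :=
  node_N1_move_of_pieces piece_c1 piece_c2 piece_dsh piece_e_free

/-- **TOP — the registered text of `stub_M2geo` (`sig_stub_M2geo.txt` VERBATIM)** through G4's landed
chain: `m2geo_of_transfer (transfer_of_swap' (swap_of_move node_N1_move))`. [cite: GompfStipsicz1999, §8.2] -/
theorem n1_design_v2 : ∀ (g : ℕ) (l l' : Literature.GroupTheory.CombinatorialGroupTheory.SignedHurwitz.IntWord g), Literature.GroupTheory.CombinatorialGroupTheory.SignedHurwitz.HurwitzStep (Literature.GroupTheory.CombinatorialGroupTheory.SignedHurwitz.stdSymp ℤ g) l l' → ∀ (X : Type) [TopologicalSpace X] [T2Space X] [SecondCountableTopology X] [CompactSpace X] [ChartedSpace (EuclideanHalfSpace 4) X] [IsManifold (𝓡∂ 4) ∞ X] (h : Fin l.length → Literature.Topology.FourManifolds.HandleAttachingMap 3 2 (Literature.Topology.FourManifolds.LefschetzBase.Base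 g)) (D : Literature.Topology.FourManifolds.HandleAttachingMap.MultiAttachmentData h (𝓡∂ 4) X) (bX : Literature.Topology.FourManifolds.BoundaryData (𝓡∂ 4) X (𝓡 3)) (Ψ : bX.carrier ≃ₘ⟮𝓡 3, 𝓡 3⟯ (Literature.Topology.FourManifolds.LefschetzBase.bBase g).carrier), Literature.Topology.FourManifolds.LefschetzBase.IsLefschetzLink g l h → (∀ (y : bX.carrier) (a : ↥(Literature.Topology.FourManifolds.HandleAttachingMap.coresComplement h)), bX.incl y = D.jA a → ∃ c : ℝ, 0 < c ∧ Literature.Topology.FourManifolds.LefschetzBase.w g ((Literature.Topology.FourManifolds.LefschetzBase.bBase g).incl (Ψ y)).1 = (c : ℂ) * Literature.Topology.FourManifolds.LefschetzBase.w g (a : Literature.Topology.FourManifolds.LefschetzBase.Base g).1) → ∃ (X' : Type) (_ : TopologicalSpace X') (_ : T2Space X') (_ : SecondCountableTopology X') (_ : CompactSpace X') (_ : ChartedSpace (EuclideanHalfSpace 4) X') (_ : IsManifold (𝓡∂ 4) ∞ X') (h' : Fin l'.length → Literature.Topology.FourManifolds.HandleAttachingMap 3 2 (Literature.Topology.FourManifolds.LefschetzBase.Base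 g)) (D' : Literature.Topology.FourManifolds.HandleAttachingMap.MultiAttachmentData h' (𝓡∂ 4) X') (G : X ≃ₘ⟮𝓡∂ 4, 𝓡∂ 4⟯ X'), Literature.Topology.FourManifolds.LefschetzBase.IsLefschetzLink g l' h' ∧ ∀ a' : ↥(Literature.Topology.FourManifolds.HandleAttachingMap.coresComplement h'), G.symm (D'.jA a') ∈ (𝓡∂ 4).boundary X → (∃ a : ↥(Literature.Topology.FourManifolds.HandleAttachingMap.coresComplement h), G.symm (D'.jA a') = D.jA a ∧ ∃ c : ℝ, 0 < c ∧ Literature.Topology.FourManifolds.LefschetzBase.w g (a' : Literature.Topology.FourManifolds.LefschetzBase.Base g).1 = (c : ℂ) * Literature.Topology.FourManifolds.LefschetzBase.w g (a : Literature.Topology.FourManifolds.LefschetzBase.Base g).1) ∨ (∃ (k : Fin l.length) (b : ↥(Literature.Topology.FourManifolds.beltPiece 3 2)), G.symm (D'.jA a') = D.jB k b ∧ G.symm (D'.jA a') ∉ Set.range D.jA ∧ ∃ c : ℝ, 0 < c ∧ Literature.Topology.FourManifolds.LefschetzBase.w g (a' : Literature.Topology.FourManifolds.LefschetzBase.Base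 g).1 = (c : ℂ) * Literature.Topology.FourManifolds.LefschetzBase.pageDir l.length k) :=
  m2geo_of_transfer (transfer_of_swap' (swap_of_move node_N1_move))

/-- **(HS) check** through G4's `hs_of_swap'`. [cite: GompfStipsicz1999, §8.2] -/
theorem hs_of_n1_v2 :
    ∀ (M : Type) [TopologicalSpace M] [T2Space M] [SecondCountableTopology M]
      [ChartedSpace (EuclideanSpace ℝ (Fin 4)) M] [IsManifold (𝓡 4) ∞ M] (g : ℕ) (l l' : IntWord g),
      ModelsOnFibred M g l → HurwitzStep (stdSymp ℤ g) l l' → ModelsOnFibred M g l' :=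
  hs_of_swap' (swap_of_move node_N1_move)

end N1MoveDesign

end Summit.SmoothPoincare4.SmoothPoincare4.Theorems.AcyclicBisectionExists.ModpBraidOrbits

end
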